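import Literature.NumberTheory.LFunctions.RodgersTaoHamiltonianProofs
import Literature.NumberTheory.LFunctions.RodgersTaoGapBoundProofs
import Literature.NumberTheory.LFunctions.RodgersTaoRiemannVonMangoldtProofs
import Mathlib.Analysis.SpecialFunctions.Pow.Real
import HarnessLib

/-!
# Rodgers–Tao 2020, Lemma 19 — RH-FREE CONTENT twin, Part I (the `t`-free core): the nearby
# row sums `S_j(T) = Σ_{k : j ∼_T k} ψ_T(k)/(ξ_j − ξ_k)` cancel, and
# `Σ_j ψ_T(j) log₊(ξ_j) |S_j(T)| = o(T log³ T)`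

RH-FREE literature proofs (no definitions, no named facts, no `sorry`). Trunk T-ANT
(`Literature/NumberTheory/LFunctions`); companion of `RodgersTaoHamiltonian.lean` (the typed,
VACUOUS-AS-PRINTED / EX-FALSO fact `Literature.NumberTheory.LFunctions.rodgers_tao_truncHamiltonian_expansion`,
Rodgers–Tao 2020 Lemma 19 = arXiv v4 Lemma 7.4) and of `RodgersTaoHamiltonianProofs.lean`,
`RodgersTaoRiemannVonMangoldtProofs.lean` (Lemma 8 = (43)–(45), CONTENT), `RodgersTaoGapBoundProofs.lean`
(`log₊` tools). C3 cell, CONTENT-TWIN programme (rt-lead standing ruling: content twins are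
0-fact new modules): this file is PART I of the Lemma 19 twin — everything here is about the
classical locations `ξ_j`, the weight `ψ_T` (66) and the nearby relation `∼_T` ONLY (no zeros of
`H_t`, no `t`, no `Λ`); Part II (`RodgersTaoTruncHamiltonianExpansionProofs.lean`) adds the
location law and assembles the expansion of `H̃_T`.

> B. Rodgers, T. Tao, *The de Bruijn–Newman constant is non-negative*, Forum Math. Pi 8 (2020)
> e6 (= arXiv:1801.05914v4 §7), **proof of Lemma 19** (FMP p. 44; v4 TeX l. 1150–1169):
> "Desymmetrizing, it suffices to show that
> `Σ_{j∈ℤ*} ψ_T(j)|x_j(t) − ξ_j| |Σ_{k∈ℤ*: j∼_T k} ψ_T(k)/(ξ_j−ξ_k)| = o_{T→∞}(T log³ T)`. (souse)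
> The inner sum can be crudely bounded by `Õ(1)` for all `j` thanks to (66), (45). By (66),
> (50), (43), it thus suffices to show that `Σ_{k: j∼_T k} ψ_T(k)/(ξ_j−ξ_k) = o_{T→∞}(log T)`
> whenever `T^{0.5} ≤ |j| ≤ T^{1.5}` (say). For `j ∼_T k`, one has `ψ_T(k) = ψ_T(j) + Õ(T^{-0.8})`,
> and the contribution of the error term is acceptable by (45), so it suffices to show that
> `Σ_{k: j∼_T k} 1/(ξ_j−ξ_k) = o_{T→∞}(log T)` (xikjd) whenever `|j| ≥ T^{0.5}`. But from (45) we
> have … `1/(ξ_j − ξ_k) = (log ξ_j/4π)·1/(j−k) + O(1/|j|)` (stat). As `k ↦ (log ξ_j/4π)·1/(j−k)`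
> is odd around `j`, and the set `{k : j ∼_T k}` is very nearly symmetric around `j`, it is then
> easy to establish (xikjd) as required."

## What is proved (all `theorem`s, 0 new facts), and the road taken

With `S_j(T) := Σ_k 1[(j,k) ∈ nearbyPairs T] ψ_T(k)/(ξ_j − ξ_k)` (the row of the index `j`; a
finitely supported sum, written as a `tsum` of the indicator of `nearbyPairs T`):

* §1 `ψ_T`-toolkit: monotonicity in `|j|`, the variation bound
  `ψ_T(j−m) − ψ_T(j+m) ≤ 200m/(T log T + (j−m))` (`truncWeight_sub_truncWeight_le`, Bernoulli), the
  profile sums `Σ_{j∈ℤ}(1+|j|/N)^{−2} ≤ 2N+2`, `Σ_j ψ_T(j) ≤ 2T log T + 2`, and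
  `Σ_j ψ_T(j) log₊² j ≤ 40 T log³ T` (`tsum_truncWeight_mul_logPlus_sq_le`, `T ≥ 3`).
* §2 `ξ`-toolkit from Lemma 8: `log₊ ξ_j ≤ C log₊ j`; `1/|ξ_j − ξ_k| ≤ C log₊(|j|+|k|)/|j−k|` (44);
  and the symmetric-pair cancellation from the corrected (45)
  (`exists_pair_inv_sub_classicalLocationZ_le`: `|1/(ξ_j−ξ_{j+m}) + 1/(ξ_j−ξ_{j−m})| ≤ A/(2π²j)`,
  the `O(1/|j|)` of (stat)).
* §3 geometry of `∼_T`: every nearby `k` has `|k−j| < R₁ := (2N)^{1/10} + 2`, `N = T² + 2|j|`,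
  indeed `|k−j| < R₃ := (N+R₁)^{1/10}`; every `0 < |m| < R₂ := (N−R₁)^{1/10}` gives a nearby `j+m`;
  and the annulus is thin: `R₃ < R₂ + 1` for `N ≥ 16` (`nearby_radii_estimates`) — this is the precise
  form of «very nearly symmetric around `j`».
* §4 the rows: finite support, the (44)-bound on a term, and the CRUDE bound
  `Σ_k |term| ≤ C(2⌈R₁⌉+1) log₊(2|j|+R₁)` («crudely bounded by `Õ(1)`»).
* §5 pairing identity `Σ_{m=−M}^{M} f(m) = f(0) + Σ_{m=1}^{M}(f(m)+f(−m))` and the row symmetry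
  `S_{−j} = −S_j`.
* §6 **the cancellation** `exists_abs_tsum_nearbyRow_le`: for `T ≥ T₀`, `0 < j`, `T ≤ j²`:
  `|S_j(T)| ≤ C T^{−1/5} log₊ j` — inner pairs `m < R₂` by §2 + the `ψ_T`-variation, the (at most
  two) annulus terms by (44); `R₁ ≲ j^{2/5}` converts everything to the scale `T^{−1/5}`.
* §7 **the summed core** `nearbyRow_weighted_tsum_le`: for every `ε > 0` there is `T₁` with
  `Σ_{j∈ℤ} ψ_T(j) log₊(ξ_j) |S_j(T)| ≤ ε T log³ T` for all `T ≥ T₁` (small rows `j² < T` by the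
  crude bound and counting, large rows by §6 and `Σ ψ_T log₊² ≲ T log³ T`).

Divergences from the printed road (statement-level: none — this is a proof-internal estimate):
(i) the printed split `T^{0.5} ≤ |j| ≤ T^{1.5}` / `|j| > T^{1.5}` is replaced by the single split
at `|j| = T^{1/2}`, the `ψ_T`-variation being bounded with its decay kept
(`200m/(T log T + j − m)`) so that no upper cutoff is needed; (ii) the rate is made explicit
(`T^{−1/5} log₊ j` per row, `O(T^{4/5} log³ T)` in total) instead of `o(log T)`; (iii) (45) is used
in the CORRECTED form of the tree (`RodgersTao2020.lemma31_iii_holds`, erratum E7: main term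
`log(ξ_j/4π)`), which is immaterial here exactly as the source says (only the `k`-independence of
the main-term coefficient is used); (iv) the location-law factor `|x_j(t) − ξ_j|` of (souse) is
replaced by its RH-free majorant shape `log₊ ξ_j` — Part II multiplies by the location constant.

bears_on: N-C/N-P (COLUMN 3 DBN). WHAT THIS IS NOT: elementary real analysis of the classical
locations `ξ_j` (the `Ψ`-inverse of (42)) and of the weight `ψ_T` — RH-free and `t`-free; the
printed Lemma 19 record `rodgers_tao_truncHamiltonian_expansion` stays VACUOUS-AS-PRINTED; nothing
here bears on the truth of RH.

## References

* B. Rodgers, T. Tao, Forum Math. Pi 8 (2020) e6, §7: Lemma 19 p. 44 and its proof, (66) p. 42,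
  (69) p. 43; Lemma 8 = (43)–(45) p. 21; §1.2 p. 7 (`∼_T`) (= arXiv:1801.05914v4 Lemma 7.4, TeX
  l. 1144–1169, Lemma 3.1).
-/

noncomputable section

open Set Filter Topology Finset Real

namespace Literature.NumberTheory.LFunctions

/-! ### §1 The weight `ψ_T` (66): monotonicity in `|j|`, variation, and the profile sums -/

/-- `ψ_T` is non-increasing in `|j|` (for `T log T > 0`). [cite: RodgersTaoFMP2020, §7 p. 42 (66)] -/
theorem truncWeight_le_truncWeight_of_abs_le {T : ℝ} (hT : 0 < T * Real.log T) {j k : ℤ}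
    (h : |(j : ℝ)| ≤ |(k : ℝ)|) : truncWeight T k ≤ truncWeight T j := by
  rw [truncWeight_eq, truncWeight_eq]
  have h1 : 0 < 1 + |(j : ℝ)| / (T * Real.log T) := by positivity
  refine inv_anti₀ (by positivity) (pow_le_pow_left₀ h1.le ?_ 100)
  gcongr

/-- Bernoulli form of the variation of the profile `s ↦ (1 + s/N)^{−100}`: for `N > 0`,
`0 ≤ s`, `0 ≤ d`, `(1 + s/N)^{−100} − (1 + (s+d)/N)^{−100} ≤ 100 d/(N + s)` («`ψ_T(k) = ψ_T(j) +
Õ(|k − j|/T)`», proof of Lemma 18, FMP p. 43; here with the decay in `s` kept).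
[cite: RodgersTaoFMP2020, §7 p. 43 (proof of Lemma 18)] -/
theorem truncWeight_profile_sub_le {N s d : ℝ} (hN : 0 < N) (hs : 0 ≤ s) (hd : 0 ≤ d) :
    ((1 + s / N) ^ 100)⁻¹ - ((1 + (s + d) / N) ^ 100)⁻¹ ≤ 100 * d / (N + s) := by
  set a : ℝ := 1 + s / N with ha_def
  set b : ℝ := 1 + (s + d) / N with hb_def
  have ha : 0 < a := by positivity
  have hb : 0 < b := by positivity
  have hab : a ≤ b := by rw [ha_def, hb_def]; gcongr; linarith
  have hr1 : a / b ≤ 1 := (div_le_one hb).2 hab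
  have hr0 : 0 < a / b := div_pos ha hb
  -- Bernoulli: (a/b)^100 ≥ 1 + 100 (a/b − 1)
  have hB : 1 + (100 : ℕ) * (a / b - 1) ≤ (1 + (a / b - 1)) ^ 100 :=
    one_add_mul_le_pow (by linarith) 100
  rw [add_sub_cancel] at hB
  have key : (a ^ 100)⁻¹ - (b ^ 100)⁻¹ = (a ^ 100)⁻¹ * (1 - (a / b) ^ 100) := by
    rw [div_pow]
    field_simp
  rw [key]
  have h1 : (a ^ 100)⁻¹ ≤ 1 := by
    refine inv_le_one_of_one_le₀ (one_le_pow₀ ?_)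
    rw [ha_def]; have : 0 ≤ s / N := by positivity
    linarith
  have h2 : 1 - (a / b) ^ 100 ≤ 100 * (1 - a / b) := by push_cast at hB; linarith
  have h3 : 1 - a / b = (d / N) / b := by
    rw [ha_def, hb_def]; field_simp; ring
  have h4 : 100 * (1 - a / b) ≤ 100 * d / (N + s) := by
    rw [h3, hb_def]
    rw [show d / N / (1 + (s + d) / N) = d / (N + s + d) by field_simp; ring]
    rw [mul_div_assoc]
    exact mul_le_mul_of_nonneg_left
      (div_le_div_of_nonneg_left hd (by positivity) (by linarith)) (by norm_num)
  have h5 : 0 ≤ 1 - (a / b) ^ 100 := sub_nonneg.2 (pow_le_one₀ hr0.le hr1)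
  calc (a ^ 100)⁻¹ * (1 - (a / b) ^ 100) ≤ 1 * (1 - (a / b) ^ 100) :=
        mul_le_mul_of_nonneg_right h1 h5
    _ ≤ 100 * d / (N + s) := by rw [one_mul]; exact h2.trans h4

/-- `ψ_T`-variation across a symmetric pair: for `T log T > 0`, `0 ≤ m ≤ j`,
`ψ_T(j − m) − ψ_T(j + m) ≤ 200 m/(T log T + (j − m))`.
[cite: RodgersTaoFMP2020, §7 p. 44 (proof of Lemma 19: `ψ_T(k) = ψ_T(j) + Õ(T^{-0.8})`)] -/
theorem truncWeight_sub_truncWeight_le {T : ℝ} (hT : 0 < T * Real.log T) {j m : ℤ} (hm : 0 ≤ m)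
    (hmj : m ≤ j) :
    truncWeight T (j - m) - truncWeight T (j + m) ≤
      200 * (m : ℝ) / (T * Real.log T + ((j : ℝ) - m)) := by
  have hjm : (0 : ℝ) ≤ (j : ℝ) - m := by exact_mod_cast sub_nonneg.2 hmj
  have hm0 : (0 : ℝ) ≤ m := by exact_mod_cast hm
  rw [truncWeight_eq, truncWeight_eq]
  have e1 : |((j - m : ℤ) : ℝ)| = (j : ℝ) - m := by push_cast; exact abs_of_nonneg hjm
  have e2 : |((j + m : ℤ) : ℝ)| = ((j : ℝ) - m) + 2 * m := by
    push_cast; rw [abs_of_nonneg (by linarith)]; ring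
  rw [e1, e2]
  have h := truncWeight_profile_sub_le hT hjm (by linarith : (0 : ℝ) ≤ 2 * m)
  calc _ ≤ 100 * (2 * (m : ℝ)) / (T * Real.log T + ((j : ℝ) - m)) := h
    _ = 200 * (m : ℝ) / (T * Real.log T + ((j : ℝ) - m)) := by ring

/-- Telescoping bound for the profile `n ↦ (1 + (n+1)/N)^{−2}`: partial sums `≤ N` (`N ≥ 1`).
[folklore] -/
private theorem truncWeight_sum_range_profile_sq_le {N : ℝ} (hN : 1 ≤ N) (M : ℕ) :
    ∑ n ∈ Finset.range M, ((1 + ((n : ℝ) + 1) / N) ^ 2)⁻¹ ≤ N := by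
  have hN0 : 0 < N := by linarith
  have hpt : ∀ n : ℕ, ((1 + ((n : ℝ) + 1) / N) ^ 2)⁻¹ ≤
      N ^ 2 * (1 / (N + n) - 1 / (N + (n + 1 : ℕ))) := by
    intro n
    have hn : (0 : ℝ) ≤ n := n.cast_nonneg
    push_cast
    rw [show ((1 + ((n : ℝ) + 1) / N) ^ 2)⁻¹ = N ^ 2 / (N + n + 1) ^ 2 by
      field_simp; ring]
    rw [show N ^ 2 * (1 / (N + n) - 1 / (N + (n + 1))) = N ^ 2 / ((N + n) * (N + n + 1)) by
      field_simp; ring]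
    refine div_le_div_of_nonneg_left (by positivity) (by positivity) ?_
    nlinarith
  calc ∑ n ∈ Finset.range M, ((1 + ((n : ℝ) + 1) / N) ^ 2)⁻¹
      ≤ ∑ n ∈ Finset.range M, N ^ 2 * (1 / (N + n) - 1 / (N + (n + 1 : ℕ))) :=
        Finset.sum_le_sum fun n _ ↦ hpt n
    _ = N ^ 2 * (1 / (N + (0 : ℕ)) - 1 / (N + M)) := by
        rw [← Finset.mul_sum, Finset.sum_range_sub' (fun n : ℕ ↦ 1 / (N + (n : ℝ))) M]
    _ ≤ N ^ 2 * (1 / N) := by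
        refine mul_le_mul_of_nonneg_left ?_ (by positivity)
        simp only [Nat.cast_zero, add_zero]
        have : 0 ≤ 1 / (N + M) := by positivity
        linarith
    _ = N := by field_simp

/-- The profile `n ↦ (1 + n/N)^{−2}` on `ℕ` is summable with sum `≤ N + 1` (`N ≥ 1`). [folklore] -/
private theorem truncWeight_tsum_profile_sq_nat_le {N : ℝ} (hN : 1 ≤ N) :
    Summable (fun n : ℕ ↦ ((1 + (n : ℝ) / N) ^ 2)⁻¹) ∧
      ∑' n : ℕ, ((1 + (n : ℝ) / N) ^ 2)⁻¹ ≤ N + 1 := by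
  have hN0 : 0 < N := by linarith
  have hnn : ∀ n : ℕ, 0 ≤ ((1 + ((n : ℝ) + 1) / N) ^ 2)⁻¹ := fun n ↦ by positivity
  have hs1 : Summable (fun n : ℕ ↦ ((1 + ((n : ℝ) + 1) / N) ^ 2)⁻¹) :=
    summable_of_sum_range_le hnn (truncWeight_sum_range_profile_sq_le hN)
  have ht1 : ∑' n : ℕ, ((1 + ((n : ℝ) + 1) / N) ^ 2)⁻¹ ≤ N :=
    Real.tsum_le_of_sum_range_le hnn (truncWeight_sum_range_profile_sq_le hN)
  have hs : Summable (fun n : ℕ ↦ ((1 + (n : ℝ) / N) ^ 2)⁻¹) := by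
    rw [← summable_nat_add_iff 1]
    have e : (fun n : ℕ ↦ ((1 + ((n + 1 : ℕ) : ℝ) / N) ^ 2)⁻¹) =
        fun n : ℕ ↦ ((1 + ((n : ℝ) + 1) / N) ^ 2)⁻¹ := by
      funext n; push_cast; rfl
    rw [e]; exact hs1
  refine ⟨hs, ?_⟩
  rw [hs.tsum_eq_zero_add]
  have e : ∑' n : ℕ, ((1 + ((n + 1 : ℕ) : ℝ) / N) ^ 2)⁻¹ = ∑' n : ℕ, ((1 + ((n : ℝ) + 1) / N) ^ 2)⁻¹ := by
    congr 1; ext n; push_cast; ring_nf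
  rw [e]
  simp only [Nat.cast_zero, zero_div, add_zero, one_pow, inv_one]
  linarith

/-- The symmetric profile `j ↦ (1 + |j|/N)^{−2}` on `ℤ` is summable with sum `≤ 2N + 2`
(`N ≥ 1`). [folklore] -/
private theorem truncWeight_tsum_profile_sq_int_le {N : ℝ} (hN : 1 ≤ N) :
    Summable (fun j : ℤ ↦ ((1 + |(j : ℝ)| / N) ^ 2)⁻¹) ∧
      ∑' j : ℤ, ((1 + |(j : ℝ)| / N) ^ 2)⁻¹ ≤ 2 * N + 2 := by
  have hN0 : 0 < N := by linarith
  obtain ⟨hsN, htN⟩ := truncWeight_tsum_profile_sq_nat_le hN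
  have e1 : ∀ n : ℕ, ((1 + |((n : ℤ) : ℝ)| / N) ^ 2)⁻¹ = ((1 + (n : ℝ) / N) ^ 2)⁻¹ := fun n ↦ by
    simp
  have e2 : ∀ n : ℕ, ((1 + |((-(n : ℤ) : ℤ) : ℝ)| / N) ^ 2)⁻¹ = ((1 + (n : ℝ) / N) ^ 2)⁻¹ := fun n ↦ by
    simp
  have hs : Summable (fun j : ℤ ↦ ((1 + |(j : ℝ)| / N) ^ 2)⁻¹) := by
    refine summable_int_iff_summable_nat_and_neg.2 ⟨?_, ?_⟩
    · simpa only [e1] using hsN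
    · simpa only [e2] using hsN
  refine ⟨hs, ?_⟩
  have h1 : HasSum (fun n : ℕ ↦ ((1 + |((n : ℤ) : ℝ)| / N) ^ 2)⁻¹ +
      ((1 + |((-(n : ℤ) : ℤ) : ℝ)| / N) ^ 2)⁻¹)
      (∑' j : ℤ, ((1 + |(j : ℝ)| / N) ^ 2)⁻¹ + ((1 + |((0 : ℤ) : ℝ)| / N) ^ 2)⁻¹) :=
    hs.hasSum.nat_add_neg
  have h2 : ∑' n : ℕ, (((1 + |((n : ℤ) : ℝ)| / N) ^ 2)⁻¹ +
      ((1 + |((-(n : ℤ) : ℤ) : ℝ)| / N) ^ 2)⁻¹) = 2 * ∑' n : ℕ, ((1 + (n : ℝ) / N) ^ 2)⁻¹ := by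
    rw [← tsum_mul_left]; refine tsum_congr fun n ↦ ?_
    rw [e1, e2]; ring
  have h0 : 0 ≤ ((1 + |((0 : ℤ) : ℝ)| / N) ^ 2)⁻¹ := by positivity
  linarith [h1.tsum_eq]

/-- `ψ_T(j) ≤ (1 + |j|/(T log T))^{−2}` (for `T log T > 0`). [cite: RodgersTaoFMP2020, §7 p. 42 (66)] -/
theorem truncWeight_le_profile_sq {T : ℝ} (hT : 0 < T * Real.log T) (j : ℤ) :
    truncWeight T j ≤ ((1 + |(j : ℝ)| / (T * Real.log T)) ^ 2)⁻¹ := by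
  rw [truncWeight_eq]
  have h1 : 1 ≤ 1 + |(j : ℝ)| / (T * Real.log T) := by
    have : 0 ≤ |(j : ℝ)| / (T * Real.log T) := by positivity
    linarith
  exact inv_anti₀ (by positivity) (pow_le_pow_right₀ h1 (by norm_num))

/-- `Σ_{j ∈ ℤ} ψ_T(j) ≤ 2 T log T + 2` for `T log T ≥ 1` (with summability).
[cite: RodgersTaoFMP2020, §7 p. 42 (66)] -/
theorem tsum_truncWeight_le {T : ℝ} (hT : 1 ≤ T * Real.log T) :
    Summable (truncWeight T) ∧ ∑' j : ℤ, truncWeight T j ≤ 2 * (T * Real.log T) + 2 := by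
  have hT0 : 0 < T * Real.log T := by linarith
  obtain ⟨hs, ht⟩ := truncWeight_tsum_profile_sq_int_le hT
  have hle := truncWeight_le_profile_sq hT0
  have hs' : Summable (truncWeight T) :=
    Summable.of_nonneg_of_le (fun j ↦ (truncWeight_pos hT0 j).le) hle hs
  exact ⟨hs', (hs'.tsum_le_tsum hle hs).trans ht⟩

/-- Pointwise: `ψ_T(j) log₊² j ≤ (2 log²(2 + N) + 2)(1 + |j|/N)^{−2}`, `N = T log T > 0`
(`log₊ j ≤ log(2+N) + log(1 + |j|/N)`). [folklore] -/
private theorem truncWeight_mul_logPlus_sq_le_profile {T : ℝ} (hT : 0 < T * Real.log T) (j : ℤ) :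
    truncWeight T j * logPlus j ^ 2 ≤
      (2 * Real.log (2 + T * Real.log T) ^ 2 + 2) * ((1 + |(j : ℝ)| / (T * Real.log T)) ^ 2)⁻¹ := by
  set N := T * Real.log T with hN
  set u := |(j : ℝ)| / N with hu
  have hu0 : 0 ≤ u := by positivity
  have h1u : 1 ≤ 1 + u := by linarith
  have h1 : logPlus (j : ℝ) ≤ Real.log (2 + N) + u := by
    rw [logPlus_eq]
    have h2 : 2 + |(j : ℝ)| ≤ (2 + N) * (1 + u) := by
      have : (2 + N) * (1 + u) = 2 + N + 2 * u + |(j : ℝ)| := by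
        rw [hu]; field_simp; ring
      rw [this]; linarith
    have h3 : Real.log (1 + u) ≤ u := by
      have := Real.log_le_sub_one_of_pos (by linarith : (0 : ℝ) < 1 + u); linarith
    calc Real.log (2 + |(j : ℝ)|) ≤ Real.log ((2 + N) * (1 + u)) :=
          Real.log_le_log (by positivity) h2
      _ = Real.log (2 + N) + Real.log (1 + u) :=
          Real.log_mul (by positivity) (by positivity)
      _ ≤ Real.log (2 + N) + u := by linarith
  have ha : 0 ≤ Real.log (2 + N) := Real.log_nonneg (by linarith)
  have h4 : logPlus (j : ℝ) ^ 2 ≤ 2 * Real.log (2 + N) ^ 2 + 2 * u ^ 2 := by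
    have := pow_le_pow_left₀ (logPlus_nonneg _) h1 2
    nlinarith [sq_nonneg (Real.log (2 + N) - u)]
  have hψ : truncWeight T j = ((1 + u) ^ 100)⁻¹ := by rw [truncWeight_eq]
  rw [hψ]
  have h5 : ((1 + u) ^ 100)⁻¹ ≤ ((1 + u) ^ 2)⁻¹ :=
    inv_anti₀ (by positivity) (pow_le_pow_right₀ h1u (by norm_num))
  have h6 : ((1 + u) ^ 100)⁻¹ * u ^ 2 ≤ ((1 + u) ^ 2)⁻¹ := by
    rw [show (1 + u) ^ 100 = (1 + u) ^ 2 * (1 + u) ^ 98 by ring, mul_inv, mul_assoc]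
    refine mul_le_of_le_one_right (by positivity) ?_
    rw [inv_mul_le_iff₀ (by positivity), mul_one]
    calc u ^ 2 ≤ (1 + u) ^ 2 := pow_le_pow_left₀ hu0 (by linarith) 2
      _ ≤ (1 + u) ^ 98 := pow_le_pow_right₀ h1u (by norm_num)
  have h7 : 0 ≤ ((1 + u) ^ 100)⁻¹ := by positivity
  calc ((1 + u) ^ 100)⁻¹ * logPlus (j : ℝ) ^ 2
      ≤ ((1 + u) ^ 100)⁻¹ * (2 * Real.log (2 + N) ^ 2 + 2 * u ^ 2) :=
        mul_le_mul_of_nonneg_left h4 h7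
    _ = 2 * Real.log (2 + N) ^ 2 * ((1 + u) ^ 100)⁻¹ + 2 * (((1 + u) ^ 100)⁻¹ * u ^ 2) := by ring
    _ ≤ 2 * Real.log (2 + N) ^ 2 * ((1 + u) ^ 2)⁻¹ + 2 * ((1 + u) ^ 2)⁻¹ := by gcongr
    _ = (2 * Real.log (2 + N) ^ 2 + 2) * ((1 + u) ^ 2)⁻¹ := by ring

/-- `log(2 + T log T) ≤ 2 log T`, `1 ≤ log T` and `1 ≤ T log T` for `T ≥ 3`. [folklore] -/
private theorem truncWeight_log_two_add_mul_log_le {T : ℝ} (hT : 3 ≤ T) :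
    Real.log (2 + T * Real.log T) ≤ 2 * Real.log T ∧ 1 ≤ Real.log T ∧ 1 ≤ T * Real.log T := by
  have hT0 : 0 < T := by linarith
  have hlogT : 1 ≤ Real.log T := by
    rw [← Real.log_exp 1]
    refine Real.log_le_log (Real.exp_pos 1) ?_
    have := Real.exp_one_lt_d9; linarith
  refine ⟨?_, hlogT, by nlinarith⟩
  have h1 : Real.log T ≤ T - 1 := by
    have := Real.log_le_sub_one_of_pos hT0; linarith
  have h2 : 2 + T * Real.log T ≤ T ^ 2 := by nlinarith
  calc Real.log (2 + T * Real.log T) ≤ Real.log (T ^ 2) :=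
        Real.log_le_log (by positivity) h2
    _ = 2 * Real.log T := by rw [Real.log_pow]; norm_num

/-- `Σ_{j ∈ ℤ} ψ_T(j) log₊² j ≤ 40 · T log³ T` for `T ≥ 3` (with summability): the one-dimensional
weighted count behind «`Σ_{j≠k} ψψ/|ξ_j − ξ_k|² ≪ T log³ T`» (proof of Lemma 21, FMP p. 48).
[cite: RodgersTaoFMP2020, §7 p. 48 (proof of Lemma 21, first display)] -/
theorem tsum_truncWeight_mul_logPlus_sq_le {T : ℝ} (hT : 3 ≤ T) :
    Summable (fun j : ℤ ↦ truncWeight T j * logPlus j ^ 2) ∧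
      ∑' j : ℤ, truncWeight T j * logPlus j ^ 2 ≤ 40 * (T * Real.log T ^ 3) := by
  obtain ⟨hlog2N, hlogT, hN1⟩ := truncWeight_log_two_add_mul_log_le hT
  have hT0 : 0 < T := by linarith
  have hN0 : 0 < T * Real.log T := by linarith
  have hpt := truncWeight_mul_logPlus_sq_le_profile hN0
  obtain ⟨hsP, htP⟩ := truncWeight_tsum_profile_sq_int_le hN1
  have hmaj : Summable (fun j : ℤ ↦ (2 * Real.log (2 + T * Real.log T) ^ 2 + 2) *
      ((1 + |(j : ℝ)| / (T * Real.log T)) ^ 2)⁻¹) := hsP.mul_left _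
  have hnn : ∀ j : ℤ, 0 ≤ truncWeight T j * logPlus j ^ 2 := fun j ↦
    mul_nonneg (truncWeight_pos hN0 j).le (sq_nonneg _)
  have hs : Summable (fun j : ℤ ↦ truncWeight T j * logPlus j ^ 2) :=
    Summable.of_nonneg_of_le hnn hpt hmaj
  refine ⟨hs, ?_⟩
  have h0 : 0 ≤ Real.log (2 + T * Real.log T) := Real.log_nonneg (by nlinarith)
  calc ∑' j : ℤ, truncWeight T j * logPlus j ^ 2
      ≤ ∑' j : ℤ, (2 * Real.log (2 + T * Real.log T) ^ 2 + 2) *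
          ((1 + |(j : ℝ)| / (T * Real.log T)) ^ 2)⁻¹ := hs.tsum_le_tsum hpt hmaj
    _ = (2 * Real.log (2 + T * Real.log T) ^ 2 + 2) *
          ∑' j : ℤ, ((1 + |(j : ℝ)| / (T * Real.log T)) ^ 2)⁻¹ := tsum_mul_left
    _ ≤ (2 * (2 * Real.log T) ^ 2 + 2 * Real.log T ^ 2) * (2 * (T * Real.log T) + 2) := by
        gcongr
        · nlinarith
    _ ≤ (10 * Real.log T ^ 2) * (4 * (T * Real.log T)) := by
        have : 2 * (T * Real.log T) + 2 ≤ 4 * (T * Real.log T) := by linarith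
        have h10 : 2 * (2 * Real.log T) ^ 2 + 2 * Real.log T ^ 2 = 10 * Real.log T ^ 2 := by ring
        rw [h10]
        exact mul_le_mul_of_nonneg_left this (by positivity)
    _ = 40 * (T * Real.log T ^ 3) := by ring

/-! ### §2 The classical locations: `1/|ξ_j − ξ_k|` from (44), `log₊ ξ_j ≍ log₊ j` from (43),
and the symmetric-pair cancellation from (45) -/

/-- `log₊(ξ_j) ≤ C log₊ j` on all of `ℤ` (Lemma 8 (i): «`log₊ ξ_j ≍ log₊ j`», extended by the
evenness of `log₊` and `ξ_0 = 0`). [cite: RodgersTaoFMP2020, Lemma 8 (i) = v4 Lemma 3.1 (i) p. 21] -/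
theorem exists_logPlus_classicalLocationZ_le :
    ∃ C : ℝ, 1 ≤ C ∧ ∀ j : ℤ, logPlus (classicalLocationZ j) ≤ C * logPlus j := by
  obtain ⟨c, C, hc, hcC, h⟩ := lemma8_i_order
  refine ⟨max C 1, le_max_right _ _, fun j ↦ ?_⟩
  have hC1 : C ≤ max C 1 := le_max_left _ _
  have key : ∀ j : ℤ, 0 < j → logPlus (classicalLocationZ j) ≤ max C 1 * logPlus j := by
    intro j hj
    have hj1 : (1 : ℝ) ≤ (j : ℝ) := by exact_mod_cast hj
    rw [classicalLocationZ_of_pos hj]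
    exact (h (j : ℝ) hj1).2.2.2.trans (mul_le_mul_of_nonneg_right hC1 (logPlus_nonneg _))
  rcases lt_trichotomy j 0 with hj | rfl | hj
  · have := key (-j) (by omega)
    rw [classicalLocationZ_neg, logPlus_neg] at this
    push_cast at this
    rwa [logPlus_neg] at this
  · simp only [classicalLocationZ_zero, Int.cast_zero]
    have := logPlus_nonneg (0 : ℝ)
    nlinarith [le_max_right C 1]
  · exact key j hj

/-- From (44): `1/|ξ_j − ξ_k| ≤ C · log₊(|j| + |k|)/|j − k|` for `j, k ∈ ℤ*` (for `j = k` both sides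
vanish), with an absolute `C > 0` (`|ξ_k − ξ_j| ≥ c|k − j|/log₊(|ξ_j| + |ξ_k|)` and
`|ξ_k| ≤ B|k|`). [cite: RodgersTaoFMP2020, Lemma 8 (ii) = v4 Lemma 3.1 (ii) eq. (44) p. 21] -/
theorem exists_inv_abs_sub_classicalLocationZ_le :
    ∃ C : ℝ, 0 < C ∧ ∀ j k : ℤ, j ≠ 0 → k ≠ 0 →
      1 / |classicalLocationZ j - classicalLocationZ k| ≤
        C * (logPlus (|(j : ℝ)| + |(k : ℝ)|) / |(j : ℝ) - k|) := by
  obtain ⟨c, C, hc, -, h44⟩ := RodgersTao2020.lemma31_ii_holds_record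
  obtain ⟨B, hB, hBle⟩ := exists_abs_classicalLocationZ_le
  set K : ℝ := Real.log (2 + B) / Real.log 2 + 1 with hK
  have hlog2 : 0 < Real.log 2 := Real.log_pos one_lt_two
  have hK0 : 0 < K := by
    have : 0 ≤ Real.log (2 + B) / Real.log 2 := div_nonneg (Real.log_nonneg (by linarith)) hlog2.le
    linarith
  refine ⟨K / c, div_pos hK0 hc, fun j k hj hk ↦ ?_⟩
  rcases eq_or_ne j k with rfl | hjk
  · simp
  have hd : 0 < |(j : ℝ) - k| := abs_pos.2 (sub_ne_zero.2 (by exact_mod_cast hjk))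
  have hd' : |(k : ℝ) - j| = |(j : ℝ) - k| := abs_sub_comm _ _
  obtain ⟨hlow, -⟩ := h44 j k hj hk
  rw [hd'] at hlow
  have hL0 : 0 < logPlus (|classicalLocationZ j| + |classicalLocationZ k|) := logPlus_pos _
  -- log₊(|ξ_j| + |ξ_k|) ≤ K log₊(|j| + |k|)
  have hL : logPlus (|classicalLocationZ j| + |classicalLocationZ k|) ≤
      K * logPlus (|(j : ℝ)| + |(k : ℝ)|) := by
    have h1 : |classicalLocationZ j| + |classicalLocationZ k| ≤ B * (|(j : ℝ)| + |(k : ℝ)|) := by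
      have := hBle j; have := hBle k; linarith
    have h2 : logPlus (|classicalLocationZ j| + |classicalLocationZ k|) ≤
        Real.log (2 + B) + logPlus (|(j : ℝ)| + |(k : ℝ)|) := by
      rw [logPlus_eq, logPlus_eq, abs_of_nonneg (by positivity : (0 : ℝ) ≤ |classicalLocationZ j| + |classicalLocationZ k|),
        abs_of_nonneg (by positivity : (0 : ℝ) ≤ |(j : ℝ)| + |(k : ℝ)|),
        ← Real.log_mul (by positivity) (by positivity)]
      refine Real.log_le_log (by positivity) ?_
      nlinarith [abs_nonneg (j : ℝ), abs_nonneg (k : ℝ), abs_nonneg (classicalLocationZ j),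
        abs_nonneg (classicalLocationZ k)]
    have h3 : Real.log (2 + B) ≤ Real.log (2 + B) / Real.log 2 * logPlus (|(j : ℝ)| + |(k : ℝ)|) := by
      rw [div_mul_eq_mul_div, le_div_iff₀ hlog2]
      exact mul_le_mul_of_nonneg_left (log_two_le_logPlus _) (Real.log_nonneg (by linarith))
    calc _ ≤ Real.log (2 + B) + logPlus (|(j : ℝ)| + |(k : ℝ)|) := h2
      _ ≤ Real.log (2 + B) / Real.log 2 * logPlus (|(j : ℝ)| + |(k : ℝ)|) +
          logPlus (|(j : ℝ)| + |(k : ℝ)|) := by linarith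
      _ = K * logPlus (|(j : ℝ)| + |(k : ℝ)|) := by rw [hK]; ring
  have hpos : 0 < |classicalLocationZ j - classicalLocationZ k| :=
    abs_pos.2 (sub_ne_zero.2 fun h ↦ hjk (strictMono_classicalLocationZ.injective h))
  have hD : |classicalLocationZ k - classicalLocationZ j| = |classicalLocationZ j - classicalLocationZ k| :=
    abs_sub_comm _ _
  rw [hD] at hlow
  have hP0 : 0 < logPlus (|(j : ℝ)| + |(k : ℝ)|) := logPlus_pos _
  have h6 : c * |(j : ℝ) - k| / (K * logPlus (|(j : ℝ)| + |(k : ℝ)|)) ≤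
      c * |(j : ℝ) - k| / logPlus (|classicalLocationZ j| + |classicalLocationZ k|) :=
    div_le_div_of_nonneg_left (by positivity) hL0 hL
  have h7 : c * |(j : ℝ) - k| / logPlus (|classicalLocationZ j| + |classicalLocationZ k|) ≤
      |classicalLocationZ j - classicalLocationZ k| := by rwa [mul_div_assoc]
  have h8 : 0 < c * |(j : ℝ) - k| / (K * logPlus (|(j : ℝ)| + |(k : ℝ)|)) := by positivity
  calc 1 / |classicalLocationZ j - classicalLocationZ k|
      ≤ 1 / (c * |(j : ℝ) - k| / (K * logPlus (|(j : ℝ)| + |(k : ℝ)|))) :=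
        one_div_le_one_div_of_le h8 (h6.trans h7)
    _ = K / c * (logPlus (|(j : ℝ)| + |(k : ℝ)|) / |(j : ℝ) - k|) := by
        field_simp

/-- The symmetric-pair cancellation from (45) (the `O(1/|j|)` term of v4 display (stat),
«`1/(ξ_j − ξ_k) = (log ξ_j/4π)·1/(j−k) + O(1/|j|)`», and the oddness of `k ↦ 1/(j−k)` around `j`):
there is an absolute `A ≥ 0` such that for integers `1 ≤ m`, `2m ≤ j` with `A m ≤ 2π j`, writing
`ℓ_j = log(ξ_j/4π)`: `ξ_{j+m} − ξ_j ≥ 2πm/ℓ_j`, `ξ_j − ξ_{j−m} ≥ 2πm/ℓ_j`, and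
`|1/(ξ_j − ξ_{j+m}) + 1/(ξ_j − ξ_{j−m})| ≤ A/(2π² j)`. Input: the corrected (45)
`RodgersTao2020.lemma31_iii_holds` (comparability constant `K = 2`).
[cite: RodgersTaoFMP2020, §7 p. 44 (v4 display (stat)), Lemma 8 (iii) eq. (45) p. 21] -/
theorem exists_pair_inv_sub_classicalLocationZ_le :
    ∃ A : ℝ, 0 ≤ A ∧ ∀ j m : ℤ, 1 ≤ m → 2 * m ≤ j → A * m ≤ 2 * π * j →
      2 * π * m / Real.log (classicalLocationZ j / (4 * π)) ≤
          classicalLocationZ (j + m) - classicalLocationZ j ∧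
      2 * π * m / Real.log (classicalLocationZ j / (4 * π)) ≤
          classicalLocationZ j - classicalLocationZ (j - m) ∧
      |1 / (classicalLocationZ j - classicalLocationZ (j + m)) +
          1 / (classicalLocationZ j - classicalLocationZ (j - m))| ≤ A / (2 * π ^ 2 * j) := by
  obtain ⟨A, hA⟩ := RodgersTao2020.lemma31_iii_holds 2 (by norm_num)
  refine ⟨max A 0, le_max_right _ _, fun j m hm hmj hAm ↦ ?_⟩
  have hπ : 0 < π := Real.pi_pos
  have hm1 : (1 : ℝ) ≤ m := by exact_mod_cast hm
  have hmj' : 2 * (m : ℝ) ≤ j := by exact_mod_cast hmj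
  have hj1 : (1 : ℝ) ≤ j := by linarith
  have hj0 : (0 : ℤ) < j := by exact_mod_cast (show (0 : ℝ) < j by linarith)
  have hjp0 : (0 : ℤ) < j + m := by omega
  have hjm0 : (0 : ℤ) < j - m := by omega
  rw [classicalLocationZ_of_pos hj0, classicalLocationZ_of_pos hjp0, classicalLocationZ_of_pos hjm0]
  push_cast
  set ξj := classicalLocation (j : ℝ) with hξj
  set ℓ := Real.log (ξj / (4 * π)) with hℓ
  set L := Real.log ξj with hL
  have hℓ1 : 1 < ℓ := RodgersTao2020.one_lt_log_classicalLocation_div hj1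
  have hℓ0 : 0 < ℓ := by linarith
  have hξ4 : 4 * π ≤ ξj := four_pi_le_classicalLocation (by linarith)
  have hξ0 : 0 < ξj := by linarith [hπ]
  have hℓL : ℓ ≤ L := by
    rw [hℓ, hL, Real.log_div hξ0.ne' (by positivity)]
    have : 0 ≤ Real.log (4 * π) := Real.log_nonneg (by linarith [Real.pi_gt_three])
    linarith
  have hL1 : 1 ≤ L := by linarith
  have hL0 : 0 < L := by linarith
  -- the two instances of (45)
  have hP := hA (j : ℝ) ((j : ℝ) + m) hj1 (by linarith) (by linarith) (by linarith)
  have hM := hA (j : ℝ) ((j : ℝ) - m) hj1 (by linarith) (by linarith) (by linarith)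
  rw [← hξj, ← hℓ, ← hL] at hP hM
  have eP : (j : ℝ) + m - j = m := by ring
  have eM : (j : ℝ) - m - j = -m := by ring
  rw [eP] at hP; rw [eM] at hM
  set E : ℝ := max A 0 * ((m : ℝ) ^ 2 / ((j : ℝ) * L ^ 2)) with hE
  have hE0 : 0 ≤ E := by positivity
  have hAle : A * ((m : ℝ) ^ 2 / ((j : ℝ) * L ^ 2)) ≤ E :=
    mul_le_mul_of_nonneg_right (le_max_left _ _) (by positivity)
  have hAle' : A * ((-(m : ℝ)) ^ 2 / ((j : ℝ) * L ^ 2)) ≤ E := by rwa [neg_sq]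
  replace hP := hP.trans hAle
  replace hM := hM.trans hAle'
  -- E ≤ 2πm/ℓ (from A m ≤ 2π j, ℓ ≤ L, 1 ≤ L)
  have hEle : E ≤ 2 * π * m / ℓ := by
    rw [hE, div_eq_mul_inv, le_div_iff₀ hℓ0]
    have h1 : max A 0 * (m : ℝ) ≤ 2 * π * j := hAm
    calc max A 0 * ((m : ℝ) ^ 2 * ((j : ℝ) * L ^ 2)⁻¹) * ℓ
        = (max A 0 * m) * m * ℓ / ((j : ℝ) * L ^ 2) := by field_simp
      _ ≤ (2 * π * j) * m * L / ((j : ℝ) * L ^ 2) := by gcongr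
      _ = 2 * π * m / L := by field_simp
      _ ≤ 2 * π * m := div_le_self (by positivity) hL1
  set dP := classicalLocation ((j : ℝ) + m) - ξj with hdP
  set dM := ξj - classicalLocation ((j : ℝ) - m) with hdM
  have hmain : 4 * π * m / ℓ - E ≥ 2 * π * m / ℓ := by
    have : 4 * π * m / ℓ = 2 * (2 * π * m / ℓ) := by ring
    linarith
  have hdPge : 2 * π * m / ℓ ≤ dP := by
    have := (abs_le.1 hP).1; linarith
  have hdMge : 2 * π * m / ℓ ≤ dM := by
    have := (abs_le.1 hM).2
    have e : 4 * π * -(m : ℝ) / ℓ = -(4 * π * m / ℓ) := by ring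
    rw [e] at this; linarith
  have hq : 0 < 2 * π * m / ℓ := by positivity
  have hdP0 : 0 < dP := hq.trans_le hdPge
  have hdM0 : 0 < dM := hq.trans_le hdMge
  refine ⟨hdPge, hdMge, ?_⟩
  -- the pair: −1/dP + 1/dM = (dP − dM)/(dP dM)
  have hsum : 1 / (ξj - classicalLocation ((j : ℝ) + m)) + 1 / (ξj - classicalLocation ((j : ℝ) - m))
      = (dP - dM) / (dP * dM) := by
    rw [show ξj - classicalLocation ((j : ℝ) + m) = -dP by rw [hdP]; ring, ← hdM]
    field_simp
    ring
  rw [hsum, abs_div, abs_of_pos (mul_pos hdP0 hdM0)]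
  have hdiff : |dP - dM| ≤ 2 * E := by
    have e1 : dP - dM = (dP - 4 * π * m / ℓ) - (dM - 4 * π * m / ℓ) := by ring
    rw [e1]
    have a1 : |dP - 4 * π * m / ℓ| ≤ E := hP
    have a2 : |dM - 4 * π * m / ℓ| ≤ E := by
      rw [hdM]
      have : ξj - classicalLocation ((j : ℝ) - m) - 4 * π * m / ℓ =
          -(classicalLocation ((j : ℝ) - m) - ξj - 4 * π * -(m : ℝ) / ℓ) := by ring
      rw [this, abs_neg]; exact hM
    calc _ ≤ |dP - 4 * π * m / ℓ| + |dM - 4 * π * m / ℓ| := abs_sub _ _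
      _ ≤ 2 * E := by linarith
  have hprod : (2 * π * m / ℓ) ^ 2 ≤ dP * dM := by
    rw [sq]; exact mul_le_mul hdPge hdMge hq.le hdP0.le
  calc |dP - dM| / (dP * dM) ≤ 2 * E / (2 * π * m / ℓ) ^ 2 := by
        gcongr
    _ = max A 0 * ℓ ^ 2 / (2 * π ^ 2 * j * L ^ 2) := by
        rw [hE]; field_simp
    _ ≤ max A 0 * L ^ 2 / (2 * π ^ 2 * j * L ^ 2) := by gcongr
    _ = max A 0 / (2 * π ^ 2 * j) := by field_simp

/-! ### §3 Geometry of the nearby relation `j ∼_T k` (`0 < |j − k| < (T² + |j| + |k|)^{1/10}`) -/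

/-- `(x^{1/10})^{10} = x` for `x ≥ 0`. [folklore] -/
private theorem nearby_rpow_tenth_pow_ten {x : ℝ} (hx : 0 ≤ x) : (x ^ (1 / 10 : ℝ)) ^ 10 = x := by
  rw [← Real.rpow_natCast, ← Real.rpow_mul hx]; norm_num

/-- `4^{1/10} ≤ 6/5` (as `(6/5)^{10} > 4`). [folklore] -/
private theorem nearby_four_rpow_tenth_le : (4 : ℝ) ^ (1 / 10 : ℝ) ≤ 6 / 5 := by
  have h0 : (0 : ℝ) ≤ 4 ^ (1 / 10 : ℝ) := by positivity
  by_contra h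
  rw [not_le] at h
  have h1 : ((6 : ℝ) / 5) ^ 10 < (4 ^ (1 / 10 : ℝ)) ^ 10 := pow_lt_pow_left₀ h (by norm_num) (by norm_num)
  rw [nearby_rpow_tenth_pow_ten (by norm_num)] at h1
  norm_num at h1

/-- `(a + 1)^{10} ≥ a^{10} + 10 a^9` for `a ≥ 0` (two terms of the binomial expansion). [folklore] -/
private theorem nearby_pow_ten_add_le {a : ℝ} (ha : 0 ≤ a) : a ^ 10 + 10 * a ^ 9 ≤ (a + 1) ^ 10 := by
  nlinarith [pow_nonneg ha 2, pow_nonneg ha 3, pow_nonneg ha 4, pow_nonneg ha 5, pow_nonneg ha 6,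
    pow_nonneg ha 7, pow_nonneg ha 8, pow_nonneg ha 9]

/-- Radius of the nearby relation: if `j ∼_T k` then `|k − j| < (2(T² + 2|j|))^{1/10} + 2` (from
`|k| ≤ |j| + |k − j|`; the `+2` covers the degenerate case `|k − j| > T² + 2|j|`).
[cite: RodgersTaoFMP2020, §1.2 p. 7 (definition of ∼_T)] -/
theorem Nearby.abs_sub_lt_radius {T : ℝ} {j k : ℤ} (h : Nearby T j k) :
    |(k : ℝ) - j| < (2 * (T ^ 2 + 2 * |(j : ℝ)|)) ^ (1 / 10 : ℝ) + 2 := by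
  obtain ⟨hjk, hlt⟩ := h
  set d : ℝ := |(k : ℝ) - j| with hd
  set N : ℝ := T ^ 2 + 2 * |(j : ℝ)| with hN
  have hN0 : 0 ≤ N := by positivity
  have hd1 : 1 ≤ d := by
    have h1 : (1 : ℤ) ≤ |k - j| := Int.one_le_abs (sub_ne_zero.2 (Ne.symm hjk))
    have h2 : ((1 : ℤ) : ℝ) ≤ ((|k - j| : ℤ) : ℝ) := by exact_mod_cast h1
    rw [Int.cast_abs, Int.cast_sub] at h2
    simpa using h2
  have hd0 : 0 ≤ d := by positivity
  have hbase : T ^ 2 + |(j : ℝ)| + |(k : ℝ)| ≤ N + d := by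
    have : |(k : ℝ)| ≤ |(j : ℝ)| + d := by
      have := abs_sub_abs_le_abs_sub (k : ℝ) j; linarith
    rw [hN]; linarith
  have hlt2 : d < (T ^ 2 + |(j : ℝ)| + |(k : ℝ)|) ^ (1 / 10 : ℝ) := by
    rw [hd, abs_sub_comm]; exact hlt
  have hlt' : d < (N + d) ^ (1 / 10 : ℝ) :=
    hlt2.trans_le (Real.rpow_le_rpow (by positivity) hbase (by norm_num))
  have hR0 : 0 ≤ (2 * N) ^ (1 / 10 : ℝ) := by positivity
  by_contra hcon
  rw [not_lt] at hcon
  have hd2 : 2 ≤ d := by linarith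
  rcases le_or_gt d N with hdN | hdN
  · have : (N + d) ^ (1 / 10 : ℝ) ≤ (2 * N) ^ (1 / 10 : ℝ) :=
      Real.rpow_le_rpow (by positivity) (by linarith) (by norm_num)
    linarith
  · have h1 : (N + d) ^ (1 / 10 : ℝ) ≤ (d ^ 2) ^ (1 / 10 : ℝ) :=
      Real.rpow_le_rpow (by positivity) (by nlinarith) (by norm_num)
    have h2 : (d ^ 2) ^ (1 / 10 : ℝ) = d ^ (1 / 5 : ℝ) := by
      rw [← Real.rpow_natCast d 2, ← Real.rpow_mul hd0]; norm_num
    have h3 : d ^ (1 / 5 : ℝ) ≤ d ^ (1 : ℝ) := Real.rpow_le_rpow_of_exponent_le hd1 (by norm_num)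
    rw [Real.rpow_one] at h3
    linarith

/-- Outer radius: if `j ∼_T k` then, with `N = T² + 2|j|` and `R₁ = (2N)^{1/10} + 2`,
`|k − j| < (N + R₁)^{1/10}`. [cite: RodgersTaoFMP2020, §1.2 p. 7 (definition of ∼_T)] -/
theorem Nearby.abs_sub_lt_outer {T : ℝ} {j k : ℤ} (h : Nearby T j k) :
    |(k : ℝ) - j| < (T ^ 2 + 2 * |(j : ℝ)| +
      ((2 * (T ^ 2 + 2 * |(j : ℝ)|)) ^ (1 / 10 : ℝ) + 2)) ^ (1 / 10 : ℝ) := by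
  have hR := h.abs_sub_lt_radius
  obtain ⟨hjk, hlt⟩ := h
  have hbase : T ^ 2 + |(j : ℝ)| + |(k : ℝ)| ≤ T ^ 2 + 2 * |(j : ℝ)| +
      ((2 * (T ^ 2 + 2 * |(j : ℝ)|)) ^ (1 / 10 : ℝ) + 2) := by
    have : |(k : ℝ)| ≤ |(j : ℝ)| + |(k : ℝ) - j| := by
      have := abs_sub_abs_le_abs_sub (k : ℝ) j; linarith
    linarith
  rw [abs_sub_comm]
  exact hlt.trans_le (Real.rpow_le_rpow (by positivity) hbase (by norm_num))

/-- Inner radius: for `j > 0` with `R₁ ≤ j` (`N = T² + 2j`, `R₁ = (2N)^{1/10} + 2`), every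
`m ≠ 0` with `|m| < R₂ = (N − R₁)^{1/10}` gives a nearby index `j + m > 0`.
[cite: RodgersTaoFMP2020, §1.2 p. 7 (definition of ∼_T)] -/
theorem nearby_add_of_abs_lt_inner {T : ℝ} {j m : ℤ} (hj : 0 < j)
    (hR₁ : (2 * (T ^ 2 + 2 * (j : ℝ))) ^ (1 / 10 : ℝ) + 2 ≤ j) (hm : m ≠ 0)
    (hmR : |(m : ℝ)| < (T ^ 2 + 2 * (j : ℝ) -
      ((2 * (T ^ 2 + 2 * (j : ℝ))) ^ (1 / 10 : ℝ) + 2)) ^ (1 / 10 : ℝ)) :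
    Nearby T j (j + m) ∧ 0 < j + m := by
  set N : ℝ := T ^ 2 + 2 * (j : ℝ) with hN
  set R₁ : ℝ := (2 * N) ^ (1 / 10 : ℝ) + 2 with hR₁def
  have hj0 : (0 : ℝ) < j := by exact_mod_cast hj
  have hjN : (j : ℝ) ≤ N := by rw [hN]; nlinarith
  have hNR : 0 ≤ N - R₁ := by linarith
  have hN0 : 0 ≤ N := by linarith
  -- R₂ ≤ R₁
  have hR₂R₁ : (N - R₁) ^ (1 / 10 : ℝ) ≤ R₁ := by
    calc (N - R₁) ^ (1 / 10 : ℝ) ≤ (2 * N) ^ (1 / 10 : ℝ) :=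
          Real.rpow_le_rpow hNR (by linarith [show (0:ℝ) ≤ R₁ by positivity]) (by norm_num)
      _ ≤ R₁ := by rw [hR₁def]; linarith
  have hmR₁ : |(m : ℝ)| < R₁ := hmR.trans_le hR₂R₁
  have hmj : |(m : ℝ)| < j := hmR₁.trans_le hR₁
  have hjm : (0 : ℝ) < j + m := by
    have := neg_abs_le (m : ℝ); linarith
  have hjm' : 0 < j + m := by exact_mod_cast hjm
  refine ⟨⟨fun h ↦ hm (by omega), ?_⟩, hjm'⟩
  push_cast
  rw [show |(j : ℝ) - (j + m)| = |(m : ℝ)| by rw [← abs_neg]; ring_nf, abs_of_pos hj0,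
    abs_of_pos hjm]
  calc |(m : ℝ)| < (N - R₁) ^ (1 / 10 : ℝ) := hmR
    _ ≤ (T ^ 2 + j + (j + m)) ^ (1 / 10 : ℝ) := by
        refine Real.rpow_le_rpow hNR ?_ (by norm_num)
        rw [hN]; have := neg_abs_le (m : ℝ); linarith

/-- The annulus between the inner and the outer radius is thinner than `1`: for `N ≥ 16`,
`R₁ = (2N)^{1/10} + 2`, one has `R₁ ≤ N/2` and `(N + R₁)^{1/10} < (N − R₁)^{1/10} + 1`, and
`(N/2)^{1/10} ≤ (N − R₁)^{1/10}`, `(2N)^{1/10} ≤ (6/5)(N/2)^{1/10}`. [folklore] -/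
private theorem nearby_radii_estimates {N : ℝ} (hN : 16 ≤ N) :
    (2 * N) ^ (1 / 10 : ℝ) + 2 ≤ N / 2 ∧
    (N / 2) ^ (1 / 10 : ℝ) ≤ (N - ((2 * N) ^ (1 / 10 : ℝ) + 2)) ^ (1 / 10 : ℝ) ∧
    1 ≤ (N / 2) ^ (1 / 10 : ℝ) ∧
    (2 * N) ^ (1 / 10 : ℝ) ≤ 6 / 5 * (N / 2) ^ (1 / 10 : ℝ) ∧
    (N + ((2 * N) ^ (1 / 10 : ℝ) + 2)) ^ (1 / 10 : ℝ) <
      (N - ((2 * N) ^ (1 / 10 : ℝ) + 2)) ^ (1 / 10 : ℝ) + 1 := by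
  have hN0 : 0 < N := by linarith
  -- (a) R₁ ≤ N/2 via (2N)^{1/10} ≤ √(2N) ≤ N/2 − 2
  have hsq : (2 * N) ^ (1 / 10 : ℝ) ≤ Real.sqrt (2 * N) := by
    rw [Real.sqrt_eq_rpow]
    exact Real.rpow_le_rpow_of_exponent_le (by linarith) (by norm_num)
  have hs : Real.sqrt (2 * N) ≤ N / 2 - 2 := by
    set s := Real.sqrt (2 * N) with hsdef
    have hs2 : s ^ 2 = 2 * N := Real.sq_sqrt (by linarith)
    have hs0 : 0 ≤ s := Real.sqrt_nonneg _
    have hs5 : 11 / 2 ≤ s := by nlinarith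
    nlinarith
  have ha : (2 * N) ^ (1 / 10 : ℝ) + 2 ≤ N / 2 := by linarith
  set R₁ := (2 * N) ^ (1 / 10 : ℝ) + 2 with hR₁
  have hR₁0 : 0 ≤ R₁ := by positivity
  set b := (N / 2) ^ (1 / 10 : ℝ) with hb
  have hb1 : 1 ≤ b := Real.one_le_rpow (by linarith) (by norm_num)
  set a := (N - R₁) ^ (1 / 10 : ℝ) with hadef
  have hNR : N / 2 ≤ N - R₁ := by linarith
  have hba : b ≤ a := Real.rpow_le_rpow (by linarith) hNR (by norm_num)
  have ha1 : 1 ≤ a := hb1.trans hba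
  -- (2N)^{1/10} = 4^{1/10} b ≤ (6/5) b
  have h2N : (2 * N) ^ (1 / 10 : ℝ) ≤ 6 / 5 * b := by
    rw [show 2 * N = 4 * (N / 2) by ring, Real.mul_rpow (by norm_num) (by linarith), ← hb]
    exact mul_le_mul_of_nonneg_right nearby_four_rpow_tenth_le (by linarith)
  refine ⟨ha, hba, hb1, h2N, ?_⟩
  -- (N + R₁)^{1/10} < a + 1: compare tenth powers
  set c := (N + R₁) ^ (1 / 10 : ℝ) with hc
  have hc0 : 0 ≤ c := by positivity
  have hc10 : c ^ 10 = N + R₁ := nearby_rpow_tenth_pow_ten (by linarith)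
  have ha10 : a ^ 10 = N - R₁ := nearby_rpow_tenth_pow_ten (by linarith)
  by_contra hcon
  rw [not_lt] at hcon
  have h1 : (a + 1) ^ 10 ≤ c ^ 10 := pow_le_pow_left₀ (by linarith) hcon 10
  have h2 := nearby_pow_ten_add_le (by linarith : 0 ≤ a)
  have h3 : a ≤ a ^ 9 := by
    calc a = a ^ 1 := (pow_one a).symm
      _ ≤ a ^ 9 := pow_le_pow_right₀ ha1 (by norm_num)
  -- N + R₁ ≥ N − R₁ + 10 a ⇒ 2 R₁ ≥ 10 a; but R₁ ≤ (6/5) b + 2 < 5 b ≤ 5 a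
  nlinarith

/-- At most one integer on each side of the thin annulus: if `R₃ < R₂ + 1` then two integers
`m, m'` with `R₂ ≤ m, m' < R₃` coincide. [folklore] -/
private theorem nearby_int_eq_of_mem_thin_annulus {R₂ R₃ : ℝ} (h : R₃ < R₂ + 1) {m m' : ℤ}
    (hm : R₂ ≤ (m : ℝ)) (hm' : (m : ℝ) < R₃) (hn : R₂ ≤ (m' : ℝ)) (hn' : (m' : ℝ) < R₃) :
    m = m' := by
  have h1 : ((m : ℝ)) - m' < 1 := by linarith
  have h2 : ((m' : ℝ)) - m < 1 := by linarith
  have h1' : m - m' < 1 := by exact_mod_cast h1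
  have h2' : m' - m < 1 := by exact_mod_cast h2
  omega

/-! ### §4 The row sums `S_j(T) = Σ_{k : j ∼_T k} ψ_T(k)/(ξ_j − ξ_k)` -/

/-- The row term vanishes off the nearby pairs. [cite: RodgersTaoFMP2020, §7 p. 43 (69)] -/
theorem nearbyRow_eq_zero {T : ℝ} {j k : ℤ} (h : (j, k) ∉ nearbyPairs T) :
    (nearbyPairs T).indicator
      (fun p : ℤ × ℤ ↦ truncWeight T p.2 / (classicalLocationZ p.1 - classicalLocationZ p.2)) (j, k) = 0 :=
  Set.indicator_of_notMem h _

/-- The row term on a nearby pair. [cite: RodgersTaoFMP2020, §7 p. 43 (69)] -/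
theorem nearbyRow_eq_of_mem {T : ℝ} {j k : ℤ} (h : (j, k) ∈ nearbyPairs T) :
    (nearbyPairs T).indicator
      (fun p : ℤ × ℤ ↦ truncWeight T p.2 / (classicalLocationZ p.1 - classicalLocationZ p.2)) (j, k) =
      truncWeight T k / (classicalLocationZ j - classicalLocationZ k) :=
  Set.indicator_of_mem h _

/-- The `k`-support of the row of `j` lies in `[j − ⌈R₁⌉, j + ⌈R₁⌉]`, `R₁ = (2(T² + 2|j|))^{1/10} + 2`.
[cite: RodgersTaoFMP2020, §1.2 p. 7 (definition of ∼_T)] -/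
theorem nearbyRow_eq_zero_of_not_mem_Icc {T : ℝ} {j k : ℤ}
    (hk : k ∉ Finset.Icc (j - ⌈(2 * (T ^ 2 + 2 * |(j : ℝ)|)) ^ (1 / 10 : ℝ) + 2⌉)
      (j + ⌈(2 * (T ^ 2 + 2 * |(j : ℝ)|)) ^ (1 / 10 : ℝ) + 2⌉)) :
    (nearbyPairs T).indicator
      (fun p : ℤ × ℤ ↦ truncWeight T p.2 / (classicalLocationZ p.1 - classicalLocationZ p.2)) (j, k) = 0 := by
  refine nearbyRow_eq_zero fun hmem ↦ hk ?_
  obtain ⟨-, -, hnb⟩ := (mem_nearbyPairs (p := (j, k))).1 hmem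
  have hR := hnb.abs_sub_lt_radius
  set R := (2 * (T ^ 2 + 2 * |(j : ℝ)|)) ^ (1 / 10 : ℝ) + 2 with hRdef
  have h1 : ((k : ℝ)) - j ≤ ⌈R⌉ := ((le_abs_self _).trans hR.le).trans (Int.le_ceil R)
  have h2 : ((j : ℝ)) - k ≤ ⌈R⌉ := by
    have := neg_abs_le ((k : ℝ) - j); linarith [Int.le_ceil R]
  rw [Finset.mem_Icc]
  constructor
  · have : ((j : ℝ)) - ⌈R⌉ ≤ k := by linarith
    exact_mod_cast this
  · have : (k : ℝ) ≤ j + ⌈R⌉ := by linarith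
    exact_mod_cast this

/-- The row of `j` is finitely supported, hence summable.
[cite: RodgersTaoFMP2020, §7 p. 44 (proof of Lemma 19)] -/
theorem summable_nearbyRow (T : ℝ) (j : ℤ) :
    Summable (fun k : ℤ ↦ (nearbyPairs T).indicator
      (fun p : ℤ × ℤ ↦ truncWeight T p.2 / (classicalLocationZ p.1 - classicalLocationZ p.2)) (j, k)) :=
  summable_of_ne_finset_zero fun _ hk ↦ nearbyRow_eq_zero_of_not_mem_Icc hk

/-- Pointwise bound for the row term from (44): `|term(j,k)| ≤ C log₊(|j| + |k|)/|j − k|` (and `0`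
off the nearby pairs), for `T log T > 0`. [cite: RodgersTaoFMP2020, Lemma 8 (ii) eq. (44) p. 21] -/
theorem exists_abs_nearbyRow_le :
    ∃ C : ℝ, 0 < C ∧ ∀ T : ℝ, 0 < T * Real.log T → ∀ j k : ℤ,
      |(nearbyPairs T).indicator
        (fun p : ℤ × ℤ ↦ truncWeight T p.2 / (classicalLocationZ p.1 - classicalLocationZ p.2)) (j, k)| ≤
      (nearbyPairs T).indicator (fun p : ℤ × ℤ ↦
        C * (logPlus (|(p.1 : ℝ)| + |(p.2 : ℝ)|) / |(p.1 : ℝ) - p.2|)) (j, k) := by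
  obtain ⟨C, hC, hle⟩ := exists_inv_abs_sub_classicalLocationZ_le
  refine ⟨C, hC, fun T hT j k ↦ ?_⟩
  by_cases hmem : (j, k) ∈ nearbyPairs T
  · rw [nearbyRow_eq_of_mem hmem, Set.indicator_of_mem hmem]
    obtain ⟨hj, hk, hnb⟩ := (mem_nearbyPairs (p := (j, k))).1 hmem
    rw [abs_div, abs_of_pos (truncWeight_pos hT k)]
    calc truncWeight T k / |classicalLocationZ j - classicalLocationZ k|
        ≤ 1 / |classicalLocationZ j - classicalLocationZ k| :=
          div_le_div_of_nonneg_right (truncWeight_le_one hT k) (abs_nonneg _)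
      _ ≤ C * (logPlus (|(j : ℝ)| + |(k : ℝ)|) / |(j : ℝ) - k|) := hle j k hj hk
  · rw [nearbyRow_eq_zero hmem, Set.indicator_of_notMem hmem, abs_zero]

/-- CRUDE ROW BOUND (all `j`): for `T log T > 0`,
`Σ_k |term(j,k)| ≤ C (2⌈R₁⌉ + 1) log₊(2|j| + R₁ + 1)`, `R₁ = (2(T² + 2|j|))^{1/10} + 2`
(every nearby `k` has `|k| ≤ |j| + R₁` and there are at most `2⌈R₁⌉ + 1` of them; «the inner sum
can be crudely bounded by `Õ(1)` for all `j`», proof of Lemma 19, FMP p. 44).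
[cite: RodgersTaoFMP2020, §7 p. 44 (proof of Lemma 19)] -/
theorem exists_tsum_abs_nearbyRow_le :
    ∃ C : ℝ, 0 < C ∧ ∀ T : ℝ, 0 < T * Real.log T → ∀ j : ℤ,
      Summable (fun k : ℤ ↦ |(nearbyPairs T).indicator
        (fun p : ℤ × ℤ ↦ truncWeight T p.2 / (classicalLocationZ p.1 - classicalLocationZ p.2)) (j, k)|) ∧
      ∑' k : ℤ, |(nearbyPairs T).indicator
        (fun p : ℤ × ℤ ↦ truncWeight T p.2 / (classicalLocationZ p.1 - classicalLocationZ p.2)) (j, k)| ≤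
      C * (2 * ⌈(2 * (T ^ 2 + 2 * |(j : ℝ)|)) ^ (1 / 10 : ℝ) + 2⌉ + 1) *
        logPlus (2 * |(j : ℝ)| + ((2 * (T ^ 2 + 2 * |(j : ℝ)|)) ^ (1 / 10 : ℝ) + 2)) := by
  obtain ⟨C, hC, hle⟩ := exists_abs_nearbyRow_le
  refine ⟨C, hC, fun T hT j ↦ ?_⟩
  set R := (2 * (T ^ 2 + 2 * |(j : ℝ)|)) ^ (1 / 10 : ℝ) + 2 with hRdef
  have hR0 : 0 ≤ R := by positivity
  set I : Finset ℤ := Finset.Icc (j - ⌈R⌉) (j + ⌈R⌉) with hI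
  set g : ℤ → ℝ := fun k ↦ |(nearbyPairs T).indicator
    (fun p : ℤ × ℤ ↦ truncWeight T p.2 / (classicalLocationZ p.1 - classicalLocationZ p.2)) (j, k)| with hg
  have hsupp : ∀ k ∉ I, g k = 0 := fun k hk ↦ by
    simp only [hg]; rw [nearbyRow_eq_zero_of_not_mem_Icc hk, abs_zero]
  have hs : Summable g := summable_of_ne_finset_zero hsupp
  refine ⟨hs, ?_⟩
  rw [tsum_eq_sum hsupp]
  -- each term ≤ C log₊(2|j| + R)
  have hterm : ∀ k ∈ I, g k ≤ C * logPlus (2 * |(j : ℝ)| + R) := by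
    intro k _
    refine (hle T hT j k).trans ?_
    by_cases hmem : (j, k) ∈ nearbyPairs T
    · rw [Set.indicator_of_mem hmem]
      obtain ⟨hj, hk, hnb⟩ := (mem_nearbyPairs (p := (j, k))).1 hmem
      have hd := hnb.abs_sub_lt_radius
      have hd1 : 1 ≤ |(j : ℝ) - k| := by
        have h1 : (1 : ℤ) ≤ |j - k| := Int.one_le_abs (sub_ne_zero.2 hnb.ne)
        have h2 : ((1 : ℤ) : ℝ) ≤ ((|j - k| : ℤ) : ℝ) := by exact_mod_cast h1
        rw [Int.cast_abs, Int.cast_sub] at h2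
        simpa using h2
      have hk' : |(k : ℝ)| ≤ |(j : ℝ)| + R := by
        have := abs_sub_abs_le_abs_sub (k : ℝ) j; linarith
      dsimp only
      calc C * (logPlus (|(j : ℝ)| + |(k : ℝ)|) / |(j : ℝ) - k|)
          ≤ C * (logPlus (|(j : ℝ)| + |(k : ℝ)|) / 1) := by
            gcongr; exact logPlus_nonneg _
        _ ≤ C * logPlus (2 * |(j : ℝ)| + R) := by
            rw [div_one]
            refine mul_le_mul_of_nonneg_left (logPlus_mono ?_) hC.le
            have h1 : (0 : ℝ) ≤ |(j : ℝ)| + |(k : ℝ)| := by positivity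
            have h2 : (0 : ℝ) ≤ 2 * |(j : ℝ)| + R := by linarith [abs_nonneg (j : ℝ)]
            rw [abs_of_nonneg h1, abs_of_nonneg h2]
            linarith
    · rw [Set.indicator_of_notMem hmem]
      exact mul_nonneg hC.le (logPlus_nonneg _)
  have hcard : (I.card : ℝ) = 2 * ⌈R⌉ + 1 := by
    obtain ⟨n, hn⟩ := Int.eq_ofNat_of_zero_le (Int.ceil_nonneg hR0)
    rw [hI, Int.card_Icc, hn]
    have : (j + (n : ℤ) + 1 - (j - n)).toNat = 2 * n + 1 := by omega
    rw [this]; push_cast; ring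
  calc ∑ k ∈ I, g k ≤ ∑ k ∈ I, C * logPlus (2 * |(j : ℝ)| + R) := Finset.sum_le_sum hterm
    _ = (I.card : ℝ) * (C * logPlus (2 * |(j : ℝ)| + R)) := by rw [Finset.sum_const, nsmul_eq_mul]
    _ = C * (2 * ⌈R⌉ + 1) * logPlus (2 * |(j : ℝ)| + R) := by rw [hcard]; ring

/-! ### §5 Symmetric pairing of the row sum -/

/-- `Σ_{m=−M}^{M} f(m) = f(0) + Σ_{m=1}^{M} (f(m) + f(−m))`. [folklore] -/
private theorem nearbyRow_sum_Icc_neg_natCast_eq (f : ℤ → ℝ) (M : ℕ) :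
    ∑ m ∈ Finset.Icc (-(M : ℤ)) M, f m = f 0 + ∑ m ∈ Finset.Icc (1 : ℤ) M, (f m + f (-m)) := by
  have hsplit : Finset.Icc (-(M : ℤ)) M =
      (Finset.Icc (-(M : ℤ)) (-1) ∪ {0}) ∪ Finset.Icc (1 : ℤ) M := by
    ext m
    simp only [Finset.mem_union, Finset.mem_Icc, Finset.mem_singleton]
    omega
  have hd1 : Disjoint (Finset.Icc (-(M : ℤ)) (-1) ∪ {0}) (Finset.Icc (1 : ℤ) M) := by
    rw [Finset.disjoint_left]
    intro m hm hm'
    simp only [Finset.mem_union, Finset.mem_Icc, Finset.mem_singleton] at hm hm'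
    omega
  have hd2 : Disjoint (Finset.Icc (-(M : ℤ)) (-1)) ({0} : Finset ℤ) := by
    rw [Finset.disjoint_left]
    intro m hm hm'
    simp only [Finset.mem_Icc, Finset.mem_singleton] at hm hm'
    omega
  rw [hsplit, Finset.sum_union hd1, Finset.sum_union hd2, Finset.sum_singleton,
    Finset.sum_add_distrib]
  have hneg : ∑ m ∈ Finset.Icc (-(M : ℤ)) (-1), f m = ∑ m ∈ Finset.Icc (1 : ℤ) M, f (-m) := by
    refine Finset.sum_nbij' (fun m ↦ -m) (fun m ↦ -m) ?_ ?_ ?_ ?_ ?_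
    · intro m hm
      simp only [Finset.mem_Icc] at hm ⊢; omega
    · intro m hm
      simp only [Finset.mem_Icc] at hm ⊢; omega
    · intro m _; simp
    · intro m _; simp
    · intro m _; simp
  rw [hneg]; ring

/-- Row symmetry: the row term at `(−j, k)` is minus the row term at `(j, −k)` (`ξ` odd, `ψ_T`
even, `∼_T` invariant under `(j,k) ↦ (−j,−k)`). [cite: RodgersTaoFMP2020, §7 p. 43 (69)] -/
theorem nearbyRow_neg (T : ℝ) (j k : ℤ) :
    (nearbyPairs T).indicator
      (fun p : ℤ × ℤ ↦ truncWeight T p.2 / (classicalLocationZ p.1 - classicalLocationZ p.2)) (-j, k) =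
    -(nearbyPairs T).indicator
      (fun p : ℤ × ℤ ↦ truncWeight T p.2 / (classicalLocationZ p.1 - classicalLocationZ p.2)) (j, -k) := by
  have hiff : (-j, k) ∈ nearbyPairs T ↔ (j, -k) ∈ nearbyPairs T := by
    simp only [mem_nearbyPairs, nearby_iff, ne_eq, neg_eq_zero, Int.cast_neg, abs_neg]
    constructor
    · rintro ⟨hj, hk, hne, hlt⟩
      refine ⟨hj, hk, fun h ↦ hne (by omega), ?_⟩
      rw [show |(j : ℝ) - -(k : ℝ)| = |-(j : ℝ) - k| by
        rw [← abs_neg]; ring_nf]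
      exact hlt
    · rintro ⟨hj, hk, hne, hlt⟩
      refine ⟨hj, hk, fun h ↦ hne (by omega), ?_⟩
      rw [show |-(j : ℝ) - k| = |(j : ℝ) - -(k : ℝ)| by
        rw [← abs_neg]; ring_nf]
      exact hlt
  by_cases hmem : (-j, k) ∈ nearbyPairs T
  · rw [nearbyRow_eq_of_mem hmem, nearbyRow_eq_of_mem (hiff.1 hmem), classicalLocationZ_neg,
      classicalLocationZ_neg, truncWeight_neg]
    rw [← neg_div_neg_eq]; ring_nf
  · rw [nearbyRow_eq_zero hmem, nearbyRow_eq_zero (fun h ↦ hmem (hiff.2 h)), neg_zero]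

/-- Row symmetry at the level of the sums: `S_{−j}(T) = −S_j(T)`.
[cite: RodgersTaoFMP2020, §7 p. 44 (proof of Lemma 19)] -/
theorem tsum_nearbyRow_neg (T : ℝ) (j : ℤ) :
    ∑' k : ℤ, (nearbyPairs T).indicator
      (fun p : ℤ × ℤ ↦ truncWeight T p.2 / (classicalLocationZ p.1 - classicalLocationZ p.2)) (-j, k) =
    -∑' k : ℤ, (nearbyPairs T).indicator
      (fun p : ℤ × ℤ ↦ truncWeight T p.2 / (classicalLocationZ p.1 - classicalLocationZ p.2)) (j, k) := by
  simp_rw [nearbyRow_neg T j]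
  rw [tsum_neg]
  congr 1
  exact (Equiv.neg ℤ).tsum_eq (fun k ↦ (nearbyPairs T).indicator
    (fun p : ℤ × ℤ ↦ truncWeight T p.2 / (classicalLocationZ p.1 - classicalLocationZ p.2)) (j, k))


/-! ### §6 The cancellation estimate for the middle rows (v4 display (xikjd)) -/

/-- Thresholds for the middle rows: for `T ≥ max 1024 ((A+1)⁴)` and `0 < j`, `T ≤ j²`, with
`N = T² + 2j`, `R₁ = (2N)^{1/10} + 2`: `32 ≤ j`, `16 ≤ N`, `R₁ ≤ (16/5) j^{2/5}`, `R₁ ≤ j/4` and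
`A R₁ ≤ 2π j`. [folklore] -/
private theorem nearbyRow_thresholds {A T : ℝ} {j : ℤ} (hA0 : 0 ≤ A) (hT : max 1024 ((A + 1) ^ 4) ≤ T)
    (hj : 0 < j) (hjT : T ≤ (j : ℝ) ^ 2) :
    32 ≤ (j : ℝ) ∧ 16 ≤ T ^ 2 + 2 * (j : ℝ) ∧
    (2 * (T ^ 2 + 2 * (j : ℝ))) ^ (1 / 10 : ℝ) + 2 ≤ 16 / 5 * (j : ℝ) ^ (2 / 5 : ℝ) ∧
    (2 * (T ^ 2 + 2 * (j : ℝ))) ^ (1 / 10 : ℝ) + 2 ≤ (j : ℝ) / 4 ∧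
    A * ((2 * (T ^ 2 + 2 * (j : ℝ))) ^ (1 / 10 : ℝ) + 2) ≤ 2 * π * j := by
  have hπ3 : 3 < π := Real.pi_gt_three
  have hT1024 : 1024 ≤ T := le_trans (le_max_left _ _) hT
  have hTA : (A + 1) ^ 4 ≤ T := le_trans (le_max_right _ _) hT
  have hT0 : 0 < T := by linarith
  have hj0 : (0 : ℝ) < j := by exact_mod_cast hj
  have hj32 : (32 : ℝ) ≤ j := by nlinarith
  have hjA : (A + 1) ^ 2 ≤ (j : ℝ) := by
    by_contra h
    rw [not_le] at h
    have h1 : 0 ≤ (A + 1) ^ 2 := sq_nonneg _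
    have : (j : ℝ) ^ 2 < ((A + 1) ^ 2) ^ 2 := by nlinarith
    nlinarith
  have hj1 : (1 : ℝ) ≤ j := by linarith
  set N : ℝ := T ^ 2 + 2 * (j : ℝ) with hN
  have hN16 : 16 ≤ N := by rw [hN]; nlinarith
  obtain ⟨-, -, hb1, h2N, -⟩ := nearby_radii_estimates hN16
  set b : ℝ := (N / 2) ^ (1 / 10 : ℝ) with hb
  have hbj : b ≤ (j : ℝ) ^ (2 / 5 : ℝ) := by
    have h1 : N / 2 ≤ (j : ℝ) ^ 4 := by
      rw [hN]
      have : T ^ 2 ≤ ((j : ℝ) ^ 2) ^ 2 := pow_le_pow_left₀ hT0.le hjT 2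
      nlinarith
    calc b ≤ ((j : ℝ) ^ 4) ^ (1 / 10 : ℝ) := Real.rpow_le_rpow (by linarith) h1 (by norm_num)
      _ = (j : ℝ) ^ (2 / 5 : ℝ) := by
          rw [← Real.rpow_natCast (j : ℝ) 4, ← Real.rpow_mul hj0.le]; norm_num
  have hj35 : (8 : ℝ) ≤ (j : ℝ) ^ (3 / 5 : ℝ) := by
    have e : (32 : ℝ) ^ (3 / 5 : ℝ) = 8 := by
      rw [show (32 : ℝ) = 2 ^ (5 : ℝ) by norm_num, ← Real.rpow_mul (by norm_num)]; norm_num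
    rw [← e]
    exact Real.rpow_le_rpow (by norm_num) hj32 (by norm_num)
  have hsplit : (j : ℝ) ^ (2 / 5 : ℝ) * (j : ℝ) ^ (3 / 5 : ℝ) = j := by
    rw [← Real.rpow_add hj0]; norm_num
  have hj25_0 : 0 ≤ (j : ℝ) ^ (2 / 5 : ℝ) := by positivity
  have hj25le : (j : ℝ) ^ (2 / 5 : ℝ) ≤ (j : ℝ) / 8 := by
    rw [le_div_iff₀ (by norm_num)]
    nlinarith [mul_le_mul_of_nonneg_left hj35 hj25_0]
  have hR₁le : (2 * N) ^ (1 / 10 : ℝ) + 2 ≤ 6 / 5 * (j : ℝ) ^ (2 / 5 : ℝ) + 2 := by linarith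
  have hj25 : (1 : ℝ) ≤ (j : ℝ) ^ (2 / 5 : ℝ) := Real.one_le_rpow hj1 (by norm_num)
  refine ⟨hj32, hN16, by linarith, by linarith, ?_⟩
  have hjA35 : A + 1 ≤ (j : ℝ) ^ (3 / 5 : ℝ) := by
    have hA1 : 1 ≤ A + 1 := by linarith
    calc A + 1 = (A + 1) ^ (1 : ℝ) := (Real.rpow_one _).symm
      _ ≤ (A + 1) ^ (6 / 5 : ℝ) := Real.rpow_le_rpow_of_exponent_le hA1 (by norm_num)
      _ = ((A + 1) ^ 2) ^ (3 / 5 : ℝ) := by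
          rw [← Real.rpow_natCast (A + 1) 2, ← Real.rpow_mul (by linarith)]; norm_num
      _ ≤ (j : ℝ) ^ (3 / 5 : ℝ) := Real.rpow_le_rpow (sq_nonneg _) hjA (by norm_num)
  have h1 : A * (j : ℝ) ^ (2 / 5 : ℝ) ≤ j := by
    calc A * (j : ℝ) ^ (2 / 5 : ℝ) ≤ (j : ℝ) ^ (3 / 5 : ℝ) * (j : ℝ) ^ (2 / 5 : ℝ) :=
          mul_le_mul_of_nonneg_right (by linarith) hj25_0
      _ = j := by rw [mul_comm]; exact hsplit
  have h2 : A * 2 ≤ 2 * j := by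
    have : (j : ℝ) ^ (3 / 5 : ℝ) ≤ (j : ℝ) ^ (1 : ℝ) :=
      Real.rpow_le_rpow_of_exponent_le hj1 (by norm_num)
    rw [Real.rpow_one] at this
    linarith
  have hπj : 3 * (j : ℝ) < π * j := mul_lt_mul_of_pos_right hπ3 hj0
  calc A * ((2 * N) ^ (1 / 10 : ℝ) + 2) ≤ A * (6 / 5 * (j : ℝ) ^ (2 / 5 : ℝ) + 2) :=
        mul_le_mul_of_nonneg_left hR₁le hA0
    _ = 6 / 5 * (A * (j : ℝ) ^ (2 / 5 : ℝ)) + A * 2 := by ring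
    _ ≤ 6 / 5 * j + 2 * j := by linarith
    _ ≤ 2 * π * j := by linarith

/-- Inner pair bound (proof of Lemma 19, the odd cancellation + `ψ_T`-variation): if both
`(j, j ± m)` are nearby pairs, `1 ≤ m`, `2m ≤ j`, `A m ≤ 2π j` (`A` the constant of the
(45)-pairing), then `|term(j, j+m) + term(j, j−m)| ≤ A/(2π² j) + 200 ℓ_j/(π (T log T + j))`,
`ℓ_j = log(ξ_j/4π)`. [cite: RodgersTaoFMP2020, §7 p. 44 (proof of Lemma 19, (xikjd)–(stat))] -/
theorem abs_nearbyRow_pair_le {T A : ℝ} (hTL0 : 0 < T * Real.log T)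
    (hpair : ∀ j m : ℤ, 1 ≤ m → 2 * m ≤ j → A * m ≤ 2 * π * j →
      2 * π * m / Real.log (classicalLocationZ j / (4 * π)) ≤
          classicalLocationZ (j + m) - classicalLocationZ j ∧
      2 * π * m / Real.log (classicalLocationZ j / (4 * π)) ≤
          classicalLocationZ j - classicalLocationZ (j - m) ∧
      |1 / (classicalLocationZ j - classicalLocationZ (j + m)) +
          1 / (classicalLocationZ j - classicalLocationZ (j - m))| ≤ A / (2 * π ^ 2 * j))
    {j m : ℤ} (hj : 0 < j) (hm1 : 1 ≤ m) (h2m : 2 * m ≤ j) (hAm : A * m ≤ 2 * π * j)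
    (hmemP : (j, j + m) ∈ nearbyPairs T) (hmemM : (j, j + -m) ∈ nearbyPairs T) :
    |(nearbyPairs T).indicator
        (fun p : ℤ × ℤ ↦ truncWeight T p.2 / (classicalLocationZ p.1 - classicalLocationZ p.2)) (j, j + m) +
      (nearbyPairs T).indicator
        (fun p : ℤ × ℤ ↦ truncWeight T p.2 / (classicalLocationZ p.1 - classicalLocationZ p.2)) (j, j + -m)|
      ≤ A / (2 * π ^ 2 * j) +
        200 * Real.log (classicalLocationZ j / (4 * π)) / (π * (T * Real.log T + j)) := by
  have hπ : 0 < π := Real.pi_pos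
  have hj0 : (0 : ℝ) < j := by exact_mod_cast hj
  have hj1 : (1 : ℝ) ≤ j := by exact_mod_cast hj
  have hm0 : (0 : ℝ) < m := by exact_mod_cast hm1
  rw [nearbyRow_eq_of_mem hmemP, nearbyRow_eq_of_mem hmemM]
  simp only [← sub_eq_add_neg]
  set ℓ : ℝ := Real.log (classicalLocationZ j / (4 * π)) with hℓ
  have hξj : classicalLocationZ j = classicalLocation (j : ℝ) := classicalLocationZ_of_pos hj
  have hℓ1 : 1 < ℓ := by
    rw [hℓ, hξj]; exact RodgersTao2020.one_lt_log_classicalLocation_div hj1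
  have hℓ0 : 0 < ℓ := by linarith
  obtain ⟨hdP, hdM, hsum⟩ := hpair j m hm1 h2m hAm
  rw [← hℓ] at hdP hdM
  set gP := 1 / (classicalLocationZ j - classicalLocationZ (j + m)) with hgP
  set gM := 1 / (classicalLocationZ j - classicalLocationZ (j - m)) with hgM
  set ψP := truncWeight T (j + m) with hψP
  set ψM := truncWeight T (j - m) with hψM
  have hq : 0 < 2 * π * m / ℓ := by positivity
  have hdM0 : 0 < classicalLocationZ j - classicalLocationZ (j - m) := hq.trans_le hdM
  have hgM0 : 0 < gM := by rw [hgM]; positivity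
  have hgMle : gM ≤ ℓ / (2 * π * m) := by
    rw [hgM, show ℓ / (2 * π * m) = 1 / (2 * π * m / ℓ) by field_simp]
    exact one_div_le_one_div_of_le hq hdM
  have hψP0 : 0 ≤ ψP := (truncWeight_pos hTL0 _).le
  have hψP1 : ψP ≤ 1 := truncWeight_le_one hTL0 _
  have hvar : ψM - ψP ≤ 200 * (m : ℝ) / (T * Real.log T + ((j : ℝ) - m)) :=
    truncWeight_sub_truncWeight_le hTL0 (by omega) (by omega)
  have hvar0 : 0 ≤ ψM - ψP := by
    rw [hψM, hψP]
    have : |((j - m : ℤ) : ℝ)| ≤ |((j + m : ℤ) : ℝ)| := by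
      push_cast
      have h2 : 2 * (m : ℝ) ≤ j := by exact_mod_cast h2m
      rw [abs_of_nonneg (by linarith), abs_of_nonneg (by linarith)]; linarith
    linarith [truncWeight_le_truncWeight_of_abs_le hTL0 this]
  have hident : ψP / (classicalLocationZ j - classicalLocationZ (j + m)) +
      ψM / (classicalLocationZ j - classicalLocationZ (j - m)) = ψP * (gP + gM) + (ψM - ψP) * gM := by
    rw [hgP, hgM]; ring
  rw [hident]
  have hjm2 : (T * Real.log T + j) / 2 ≤ T * Real.log T + ((j : ℝ) - m) := by
    have : 2 * (m : ℝ) ≤ j := by exact_mod_cast h2m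
    linarith
  have hpos2 : 0 < (T * Real.log T + j) / 2 := by positivity
  have hden : 0 < T * Real.log T + ((j : ℝ) - m) := hpos2.trans_le hjm2
  calc |ψP * (gP + gM) + (ψM - ψP) * gM|
      ≤ |ψP * (gP + gM)| + |(ψM - ψP) * gM| := abs_add_le _ _
    _ = ψP * |gP + gM| + (ψM - ψP) * gM := by
        rw [abs_mul, abs_of_nonneg hψP0, abs_mul, abs_of_nonneg hvar0, abs_of_pos hgM0]
    _ ≤ 1 * (A / (2 * π ^ 2 * j)) +
        (200 * (m : ℝ) / (T * Real.log T + ((j : ℝ) - m))) * (ℓ / (2 * π * m)) :=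
        add_le_add (mul_le_mul hψP1 hsum (abs_nonneg _) zero_le_one)
          (mul_le_mul hvar hgMle hgM0.le (div_nonneg (by positivity) hden.le))
    _ = A / (2 * π ^ 2 * j) + 100 * ℓ / (π * (T * Real.log T + ((j : ℝ) - m))) := by
        field_simp; ring
    _ ≤ A / (2 * π ^ 2 * j) + 100 * ℓ / (π * ((T * Real.log T + j) / 2)) := by
        gcongr
    _ = A / (2 * π ^ 2 * j) + 200 * ℓ / (π * (T * Real.log T + j)) := by
        field_simp; ring

/-- Outer (annulus) bound: a row term `term(j, j + m')` with `R₂ ≤ |m'| ≤ j/2` is at most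
`C_ξ · 4 log₊ j/R₂` (from (44); `log₊(j + |j + m'|) ≤ log₊ 3j ≤ 4 log₊ j`).
[cite: RodgersTaoFMP2020, §7 p. 44 (proof of Lemma 19), Lemma 8 (ii) eq. (44) p. 21] -/
theorem abs_nearbyRow_far_le {T C R₂ : ℝ} (hTL0 : 0 < T * Real.log T) (hC : 0 < C)
    (hrow : ∀ j k : ℤ,
      |(nearbyPairs T).indicator
        (fun p : ℤ × ℤ ↦ truncWeight T p.2 / (classicalLocationZ p.1 - classicalLocationZ p.2)) (j, k)| ≤
      (nearbyPairs T).indicator (fun p : ℤ × ℤ ↦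
        C * (logPlus (|(p.1 : ℝ)| + |(p.2 : ℝ)|) / |(p.1 : ℝ) - p.2|)) (j, k))
    {j m' : ℤ} (hj : 0 < j) (hR₂0 : 0 < R₂) (hm'R : R₂ ≤ |(m' : ℝ)|) (hm'j : |(m' : ℝ)| ≤ j / 2) :
    |(nearbyPairs T).indicator
        (fun p : ℤ × ℤ ↦ truncWeight T p.2 / (classicalLocationZ p.1 - classicalLocationZ p.2)) (j, j + m')|
      ≤ C * (4 * logPlus j) / R₂ := by
  have hj0 : (0 : ℝ) < j := by exact_mod_cast hj
  have hjabs : |(j : ℝ)| = j := abs_of_pos hj0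
  have _hT := hTL0
  have hlog3 : logPlus (3 * (j : ℝ)) ≤ 4 * logPlus j := by
    calc logPlus (3 * (j : ℝ)) ≤ logPlus (2 * (2 * (j : ℝ))) :=
          logPlus_mono (by rw [abs_of_nonneg (by linarith), abs_of_nonneg (by linarith)]; linarith)
      _ ≤ 2 * logPlus (2 * (j : ℝ)) := logPlus_two_mul_le (by linarith)
      _ ≤ 2 * (2 * logPlus (j : ℝ)) := by
          have := logPlus_two_mul_le hj0.le; linarith
      _ = 4 * logPlus j := by ring
  refine (hrow j (j + m')).trans ?_
  by_cases hmem : (j, j + m') ∈ nearbyPairs T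
  · rw [Set.indicator_of_mem hmem]
    dsimp only
    push_cast
    rw [show (j : ℝ) - (j + m') = -m' by ring, abs_neg, hjabs]
    have h1 : logPlus ((j : ℝ) + |(j : ℝ) + m'|) ≤ 4 * logPlus j := by
      refine le_trans (logPlus_mono ?_) hlog3
      have hx0 : 0 ≤ (j : ℝ) + |(j : ℝ) + m'| := by positivity
      have hin : |(j : ℝ) + m'| ≤ j + |(m' : ℝ)| := by
        have := abs_add_le (j : ℝ) m'; rwa [hjabs] at this
      rw [abs_of_nonneg hx0, abs_of_pos (by linarith : (0 : ℝ) < 3 * j)]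
      linarith
    have hm'0 : 0 < |(m' : ℝ)| := hR₂0.trans_le hm'R
    calc C * (logPlus ((j : ℝ) + |(j : ℝ) + m'|) / |(m' : ℝ)|)
        ≤ C * (4 * logPlus j / R₂) := by
          refine mul_le_mul_of_nonneg_left ?_ hC.le
          calc logPlus ((j : ℝ) + |(j : ℝ) + m'|) / |(m' : ℝ)| ≤ 4 * logPlus j / |(m' : ℝ)| :=
                div_le_div_of_nonneg_right h1 hm'0.le
            _ ≤ 4 * logPlus j / R₂ :=
                div_le_div_of_nonneg_left (by linarith [logPlus_nonneg (j : ℝ)]) hR₂0 hm'R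
      _ = C * (4 * logPlus j) / R₂ := by ring
  · rw [Set.indicator_of_notMem hmem]
    have := logPlus_nonneg (j : ℝ); positivity

/-- A sum over a finset all of whose relevant members coincide: if every two members of
`s.filter (g ≠ 0)` are equal and `|g| ≤ B` on `s` (`B ≥ 0`), then `Σ_s |g| ≤ B`. [folklore] -/
private theorem nearbyRow_sum_abs_le_of_filter_subsingleton {s : Finset ℤ} {g : ℤ → ℝ} {B : ℝ} (hB : 0 ≤ B)
    (hle : ∀ m ∈ s, |g m| ≤ B)
    (hsub : ∀ m ∈ s.filter (fun m ↦ |g m| ≠ 0), ∀ m' ∈ s.filter (fun m ↦ |g m| ≠ 0), m = m') :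
    ∑ m ∈ s, |g m| ≤ B := by
  rw [← Finset.sum_filter_ne_zero]
  have hc : (s.filter (fun m ↦ |g m| ≠ 0)).card ≤ 1 := Finset.card_le_one.2 hsub
  calc ∑ m ∈ s.filter (fun m ↦ |g m| ≠ 0), |g m|
      ≤ ∑ m ∈ s.filter (fun m ↦ |g m| ≠ 0), B :=
        Finset.sum_le_sum fun m hm ↦ hle m (Finset.mem_filter.1 hm).1
    _ = (s.filter (fun m ↦ |g m| ≠ 0)).card * B := by rw [Finset.sum_const, nsmul_eq_mul]
    _ ≤ 1 * B := mul_le_mul_of_nonneg_right (by exact_mod_cast hc) hB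
    _ = B := one_mul _

/-- Conversions of the three pieces to the scale `T^{−1/5}`: under the thresholds of
`nearbyRow_thresholds` (`R₁ ≤ (16/5) j^{2/5}`, `T ≤ j²`, `T ≥ 1`) and with `(6/5)·b ≥ T^{1/5}`-type
control of the inner radius, `R₁/j ≤ (16/5)T^{−1/5}`, `R₁/(T log T + j) ≤ (16/5) T^{−1/5}`.
[folklore] -/
private theorem nearby_radius_ratio_le {T R₁ : ℝ} {j : ℤ} (hT1 : 1 ≤ T) (hlogT : 1 ≤ Real.log T)
    (hj : 0 < j) (hjT : T ≤ (j : ℝ) ^ 2) (hR₁0 : 0 ≤ R₁)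
    (hR₁le : R₁ ≤ 16 / 5 * (j : ℝ) ^ (2 / 5 : ℝ)) :
    R₁ / j ≤ 16 / 5 * T ^ (-(1 / 5 : ℝ)) ∧
      R₁ / (T * Real.log T + j) ≤ 16 / 5 * T ^ (-(1 / 5 : ℝ)) := by
  have hT0 : 0 < T := by linarith
  have hj0 : (0 : ℝ) < j := by exact_mod_cast hj
  have hj1 : (1 : ℝ) ≤ j := by exact_mod_cast hj
  set τ : ℝ := T ^ (-(1 / 5 : ℝ)) with hτ
  have hτ0 : 0 < τ := Real.rpow_pos_of_pos hT0 _
  have hT15 : T ^ (1 / 5 : ℝ) * τ = 1 := by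
    rw [hτ, Real.rpow_neg hT0.le, mul_inv_cancel₀ (Real.rpow_pos_of_pos hT0 _).ne']
  have hT15j : T ^ (1 / 5 : ℝ) ≤ (j : ℝ) ^ (2 / 5 : ℝ) := by
    calc T ^ (1 / 5 : ℝ) ≤ ((j : ℝ) ^ 2) ^ (1 / 5 : ℝ) := Real.rpow_le_rpow hT0.le hjT (by norm_num)
      _ = (j : ℝ) ^ (2 / 5 : ℝ) := by
          rw [← Real.rpow_natCast (j : ℝ) 2, ← Real.rpow_mul hj0.le]; norm_num
  constructor
  · rw [div_le_iff₀ hj0]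
    have h1 : (j : ℝ) ^ (2 / 5 : ℝ) * T ^ (1 / 5 : ℝ) ≤ j := by
      calc (j : ℝ) ^ (2 / 5 : ℝ) * T ^ (1 / 5 : ℝ) ≤ (j : ℝ) ^ (2 / 5 : ℝ) * (j : ℝ) ^ (2 / 5 : ℝ) :=
            mul_le_mul_of_nonneg_left hT15j (by positivity)
        _ = (j : ℝ) ^ (4 / 5 : ℝ) := by rw [← Real.rpow_add hj0]; norm_num
        _ ≤ (j : ℝ) ^ (1 : ℝ) := Real.rpow_le_rpow_of_exponent_le hj1 (by norm_num)
        _ = j := Real.rpow_one _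
    have h2 : (j : ℝ) ^ (2 / 5 : ℝ) ≤ τ * j := by
      have := mul_le_mul_of_nonneg_right h1 hτ0.le
      rw [mul_assoc, hT15, mul_one] at this
      linarith
    calc R₁ ≤ 16 / 5 * (j : ℝ) ^ (2 / 5 : ℝ) := hR₁le
      _ ≤ 16 / 5 * (τ * j) := by linarith
      _ = 16 / 5 * τ * j := by ring
  · set Q : ℝ := max T (j : ℝ) with hQ
    have hQ1 : 1 ≤ Q := le_trans hT1 (le_max_left _ _)
    have hQ0 : 0 < Q := by linarith
    have hQle : Q ≤ T * Real.log T + j := by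
      rw [hQ]; refine max_le ?_ ?_ <;> nlinarith
    have hjQ : (j : ℝ) ^ (2 / 5 : ℝ) ≤ Q ^ (2 / 5 : ℝ) :=
      Real.rpow_le_rpow hj0.le (le_max_right _ _) (by norm_num)
    have hQτ : Q ^ (2 / 5 : ℝ) / Q ≤ τ := by
      have e1 : Q ^ (2 / 5 : ℝ) / Q = Q ^ ((2 / 5 : ℝ) - 1) := by
        rw [Real.rpow_sub_one hQ0.ne']
      rw [e1]
      calc Q ^ ((2 / 5 : ℝ) - 1) ≤ Q ^ (-(1 / 5) : ℝ) :=
            Real.rpow_le_rpow_of_exponent_le hQ1 (by norm_num)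
        _ ≤ T ^ (-(1 / 5) : ℝ) :=
            Real.rpow_le_rpow_of_nonpos hT0 (le_max_left _ _) (by norm_num)
    calc R₁ / (T * Real.log T + j) ≤ R₁ / Q := div_le_div_of_nonneg_left hR₁0 hQ0 hQle
      _ ≤ (16 / 5 * (j : ℝ) ^ (2 / 5 : ℝ)) / Q := div_le_div_of_nonneg_right hR₁le hQ0.le
      _ ≤ 16 / 5 * Q ^ (2 / 5 : ℝ) / Q := by gcongr
      _ = 16 / 5 * (Q ^ (2 / 5 : ℝ) / Q) := by ring
      _ ≤ 16 / 5 * τ := by linarith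

/-- `1/R₂ ≤ (6/5) T^{−1/5}` for the inner radius (`R₂ ≥ (N/2)^{1/10}`, `N ≥ T²`, `2^{1/10} ≤ 6/5`).
[folklore] -/
private theorem nearby_inv_inner_radius_le {T N R₂ : ℝ} (hT0 : 0 < T) (hNT : T ^ 2 ≤ N) (hR₂0 : 0 < R₂)
    (hbR₂ : (N / 2) ^ (1 / 10 : ℝ) ≤ R₂) : 1 / R₂ ≤ 6 / 5 * T ^ (-(1 / 5 : ℝ)) := by
  have hT15 : T ^ (1 / 5 : ℝ) * T ^ (-(1 / 5 : ℝ)) = 1 := by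
    rw [Real.rpow_neg hT0.le, mul_inv_cancel₀ (Real.rpow_pos_of_pos hT0 _).ne']
  have hτ0 : 0 < T ^ (-(1 / 5 : ℝ)) := Real.rpow_pos_of_pos hT0 _
  have h1 : T ^ (1 / 5 : ℝ) ≤ 6 / 5 * (N / 2) ^ (1 / 10 : ℝ) := by
    have e1 : T ^ (1 / 5 : ℝ) = (T ^ 2) ^ (1 / 10 : ℝ) := by
      rw [← Real.rpow_natCast T 2, ← Real.rpow_mul hT0.le]; norm_num
    have e2 : (T ^ 2) ^ (1 / 10 : ℝ) ≤ (2 * (N / 2)) ^ (1 / 10 : ℝ) :=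
      Real.rpow_le_rpow (by positivity) (by linarith) (by norm_num)
    rw [e1]
    refine e2.trans ?_
    have hN2 : 0 ≤ N / 2 := by nlinarith
    rw [Real.mul_rpow (by norm_num) hN2]
    refine mul_le_mul_of_nonneg_right ?_ (Real.rpow_nonneg hN2 _)
    calc (2 : ℝ) ^ (1 / 10 : ℝ) ≤ 4 ^ (1 / 10 : ℝ) :=
          Real.rpow_le_rpow (by norm_num) (by norm_num) (by norm_num)
      _ ≤ 6 / 5 := nearby_four_rpow_tenth_le
  have h2 : T ^ (1 / 5 : ℝ) ≤ 6 / 5 * R₂ := h1.trans (by linarith)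
  rw [div_le_iff₀ hR₂0]
  have := mul_le_mul_of_nonneg_right h2 hτ0.le
  rw [hT15] at this
  linarith

/-- Numerics: `8/(5π²) ≤ log 2`. [folklore] -/
private theorem nearbyRow_numeric_one : 8 / (5 * π ^ 2) ≤ Real.log 2 := by
  have hπ3 : 3 < π := Real.pi_gt_three
  have hlog2 : (0.69 : ℝ) ≤ Real.log 2 := by
    have := Real.log_two_gt_d9; linarith
  have h9 : 9 < π ^ 2 := by nlinarith
  have : 8 / (5 * π ^ 2) ≤ (0.69 : ℝ) := by
    rw [div_le_iff₀ (by positivity)]; nlinarith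
  linarith

/-- Numerics: `640/π ≤ 214`. [folklore] -/
private theorem nearbyRow_numeric_two : 640 / π ≤ (214 : ℝ) := by
  have hπ3 : 3 < π := Real.pi_gt_three
  rw [div_le_iff₀ Real.pi_pos]; nlinarith

-- The assembly below elaborates in ≈ 170k heartbeats (many hypotheses in context for `linarith`);
-- the explicit limit gives a ×2 margin over the default (cell rule RR: `400000 in` on long proofs).
set_option maxHeartbeats 400000 in
/-- THE `t`-FREE CORE of Lemma 19 (v4 displays (souse)–(xikjd)–(stat), FMP p. 44): there are
`C, T₀` such that for `T ≥ T₀` and every positive index `j` with `j² ≥ T`,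
`|S_j(T)| = |Σ_{k : j ∼_T k} ψ_T(k)/(ξ_j − ξ_k)| ≤ C · T^{−1/5} · log₊ j`
(«As `k ↦ (log ξ_j/4π)·1/(j−k)` is odd around `j`, and the set `{k : j ∼_T k}` is very nearly
symmetric around `j`, it is then easy to establish (xikjd)»). Road: the `k = j ± m` with
`m < R₂` (all nearby) are paired — pair sum `O(1/j)` by (45) plus the `ψ_T`-variation; the nearby
`k` with `|k − j| ≥ R₂` lie in an annulus of width `< 1` (at most one on each side), each
`O(log₊ j/R₂)`; `R₁ ≍ R₂ ≍ (T² + 2j)^{1/10}`.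
[cite: RodgersTaoFMP2020, §7 p. 44 (proof of Lemma 19, displays (souse)–(stat) of arXiv v4)] -/
theorem exists_abs_tsum_nearbyRow_le :
    ∃ C T₀ : ℝ, 0 < C ∧ 16 ≤ T₀ ∧ ∀ T : ℝ, T₀ ≤ T → ∀ j : ℤ, 0 < j → T ≤ (j : ℝ) ^ 2 →
      |∑' k : ℤ, (nearbyPairs T).indicator
        (fun p : ℤ × ℤ ↦ truncWeight T p.2 / (classicalLocationZ p.1 - classicalLocationZ p.2)) (j, k)| ≤
      C * T ^ (-(1 / 5 : ℝ)) * logPlus j := by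
  obtain ⟨A, hA0, hpair⟩ := exists_pair_inv_sub_classicalLocationZ_le
  obtain ⟨Cξ, hCξ, hrow⟩ := exists_abs_nearbyRow_le
  obtain ⟨CL, hCL1, hlogξ⟩ := exists_logPlus_classicalLocationZ_le
  have hπ : 0 < π := Real.pi_pos
  have hπ3 : 3 < π := Real.pi_gt_three
  refine ⟨A + 214 * CL + 10 * Cξ, max 1024 ((A + 1) ^ 4), by positivity,
    le_trans (by norm_num) (le_max_left _ _), fun T hT j hj hjT ↦ ?_⟩
  obtain ⟨hj32, hN16, hR₁le', hR₁j4, hAR₁⟩ := nearbyRow_thresholds hA0 hT hj hjT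
  have hT1024 : 1024 ≤ T := le_trans (le_max_left _ _) hT
  have hT1 : 1 ≤ T := by linarith
  have hT0 : 0 < T := by linarith
  have hj0 : (0 : ℝ) < j := by exact_mod_cast hj
  have hjabs : |(j : ℝ)| = j := abs_of_pos hj0
  have hj1 : (1 : ℝ) ≤ j := by linarith
  have hlogT : 1 ≤ Real.log T := by
    rw [← Real.log_exp 1]
    refine Real.log_le_log (Real.exp_pos 1) ?_
    have := Real.exp_one_lt_d9; linarith
  have hTL0 : 0 < T * Real.log T := mul_pos hT0 (by linarith)
  -- the radii
  set N : ℝ := T ^ 2 + 2 * (j : ℝ) with hN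
  have hNT : T ^ 2 ≤ N := by rw [hN]; linarith
  obtain ⟨hR₁N, hbR₂, hb1, h2N, hthin⟩ := nearby_radii_estimates hN16
  set R₁ : ℝ := (2 * N) ^ (1 / 10 : ℝ) + 2 with hR₁
  set R₂ : ℝ := (N - R₁) ^ (1 / 10 : ℝ) with hR₂
  set R₃ : ℝ := (N + R₁) ^ (1 / 10 : ℝ) with hR₃
  have hR₁0 : 0 ≤ R₁ := by positivity
  have hR₂0 : 0 < R₂ := lt_of_lt_of_le (by linarith) hbR₂
  have hR₂R₁ : R₂ ≤ R₁ := by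
    calc R₂ ≤ (2 * N) ^ (1 / 10 : ℝ) :=
          Real.rpow_le_rpow (by linarith) (by linarith) (by norm_num)
      _ ≤ R₁ := by linarith
  have hR₃R₁ : R₃ ≤ R₁ := by
    calc R₃ ≤ (2 * N) ^ (1 / 10 : ℝ) :=
          Real.rpow_le_rpow (by linarith) (by linarith) (by norm_num)
      _ ≤ R₁ := by linarith
  -- the function f m := row (j, j + m)
  set F : ℤ × ℤ → ℝ := fun p ↦ truncWeight T p.2 / (classicalLocationZ p.1 - classicalLocationZ p.2)
    with hF
  set f : ℤ → ℝ := fun m ↦ (nearbyPairs T).indicator F (j, j + m) with hf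
  -- Step 1: reindex k = j + m
  have hreidx : ∑' k : ℤ, (nearbyPairs T).indicator F (j, k) = ∑' m : ℤ, f m :=
    ((Equiv.addLeft j).tsum_eq (fun k ↦ (nearbyPairs T).indicator F (j, k))).symm
  rw [hreidx]
  -- Step 2: support of f ⊆ Icc (−M) M
  set M : ℕ := ⌈R₁⌉₊ with hM
  have hMR₁ : R₁ ≤ M := Nat.le_ceil R₁
  have hnear_rad : ∀ m : ℤ, (j, j + m) ∈ nearbyPairs T → |(m : ℝ)| < R₃ := by
    intro m hmem
    obtain ⟨-, -, hnb⟩ := (mem_nearbyPairs (p := (j, j + m))).1 hmem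
    have := hnb.abs_sub_lt_outer
    rw [hjabs] at this
    push_cast at this
    rw [show (j : ℝ) + m - j = m by ring] at this
    exact this
  have hsupp : ∀ m ∉ Finset.Icc (-(M : ℤ)) M, f m = 0 := by
    intro m hm
    refine nearbyRow_eq_zero fun hmem ↦ hm ?_
    have h1 : |(m : ℝ)| < M := ((hnear_rad m hmem).trans_le hR₃R₁).trans_le hMR₁
    rw [Finset.mem_Icc]
    have h2 := abs_lt.1 h1
    constructor
    · exact_mod_cast h2.1.le
    · exact_mod_cast h2.2.le
  rw [tsum_eq_sum hsupp, nearbyRow_sum_Icc_neg_natCast_eq]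
  have hf0 : f 0 = 0 := by
    refine nearbyRow_eq_zero fun hmem ↦ ?_
    obtain ⟨-, -, hnb⟩ := (mem_nearbyPairs (p := (j, j + 0))).1 hmem
    exact hnb.ne (by simp)
  rw [hf0, zero_add]
  -- Step 3: split Icc 1 M = Icc 1 M₂ ∪ Ioc M₂ M
  set M₂ : ℕ := ⌈R₂⌉₊ - 1 with hM₂
  have hceil₂ : 1 ≤ ⌈R₂⌉₊ := Nat.one_le_iff_ne_zero.2 (by
    intro h; rw [Nat.ceil_eq_zero] at h; linarith)
  have hM₂R₂ : (M₂ : ℝ) < R₂ := by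
    rw [hM₂, Nat.cast_sub hceil₂, Nat.cast_one]
    have := Nat.ceil_lt_add_one hR₂0.le; linarith
  have hM₂R₂' : R₂ ≤ (M₂ : ℝ) + 1 := by
    rw [hM₂, Nat.cast_sub hceil₂, Nat.cast_one]
    have := Nat.le_ceil R₂; linarith
  have hM₂M : M₂ ≤ M := by
    rw [hM₂, hM]
    exact le_trans (Nat.sub_le _ _) (Nat.ceil_mono hR₂R₁)
  have hsplit : Finset.Icc (1 : ℤ) M = Finset.Icc (1 : ℤ) M₂ ∪ Finset.Ioc (M₂ : ℤ) M := by
    ext m; simp only [Finset.mem_union, Finset.mem_Icc, Finset.mem_Ioc]; omega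
  have hdisj : Disjoint (Finset.Icc (1 : ℤ) M₂) (Finset.Ioc (M₂ : ℤ) M) := by
    rw [Finset.disjoint_left]; intro m hm hm'
    simp only [Finset.mem_Icc, Finset.mem_Ioc] at hm hm'; omega
  rw [hsplit, Finset.sum_union hdisj]
  -- Step 4: the inner pairs
  set ℓ : ℝ := Real.log (classicalLocationZ j / (4 * π)) with hℓ
  have hℓL : ℓ ≤ CL * logPlus j := by
    have h4π : 4 * π ≤ classicalLocationZ j := four_pi_le_classicalLocationZ hj
    have hξ0 : 0 < classicalLocationZ j := by linarith
    calc ℓ = Real.log (classicalLocationZ j) - Real.log (4 * π) := by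
          rw [hℓ, Real.log_div hξ0.ne' (by positivity)]
      _ ≤ Real.log (classicalLocationZ j) := by
          have : 0 ≤ Real.log (4 * π) := Real.log_nonneg (by linarith); linarith
      _ ≤ logPlus (classicalLocationZ j) := log_le_logPlus _
      _ ≤ CL * logPlus j := hlogξ j
  have hℓ0 : 0 < ℓ := by
    have hξj : classicalLocationZ j = classicalLocation (j : ℝ) := classicalLocationZ_of_pos hj
    have := RodgersTao2020.one_lt_log_classicalLocation_div hj1
    rw [← hξj] at this; rw [hℓ]; linarith
  have hR₁j : (2 * (T ^ 2 + 2 * (j : ℝ))) ^ (1 / 10 : ℝ) + 2 ≤ j := by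
    show R₁ ≤ j; linarith
  have hinner : ∀ m ∈ Finset.Icc (1 : ℤ) M₂,
      |f m + f (-m)| ≤ A / (2 * π ^ 2 * j) + 200 * ℓ / (π * (T * Real.log T + j)) := by
    intro m hm
    rw [Finset.mem_Icc] at hm
    have hm1 : (1 : ℝ) ≤ m := by exact_mod_cast hm.1
    have hmM₂ : (m : ℝ) ≤ M₂ := by exact_mod_cast hm.2
    have hmR₂ : |(m : ℝ)| < R₂ := by rw [abs_of_pos (by linarith)]; linarith
    have hmR₂' : |((-m : ℤ) : ℝ)| < R₂ := by push_cast; rw [abs_neg]; exact hmR₂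
    obtain ⟨hnbP, hposP⟩ := nearby_add_of_abs_lt_inner hj hR₁j (by omega : m ≠ 0) hmR₂
    obtain ⟨hnbM, hposM⟩ := nearby_add_of_abs_lt_inner hj hR₁j (by omega : -m ≠ 0) hmR₂'
    have hmemP : (j, j + m) ∈ nearbyPairs T :=
      (mem_nearbyPairs (p := (j, j + m))).2 ⟨hj.ne', hposP.ne', hnbP⟩
    have hmemM : (j, j + -m) ∈ nearbyPairs T :=
      (mem_nearbyPairs (p := (j, j + -m))).2 ⟨hj.ne', hposM.ne', hnbM⟩
    have h2m : 2 * m ≤ j := by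
      have : 2 * (m : ℝ) ≤ j := by linarith
      exact_mod_cast this
    have hAm : A * m ≤ 2 * π * j := by
      have : A * (m : ℝ) ≤ A * R₁ := mul_le_mul_of_nonneg_left (by linarith) hA0
      linarith
    exact abs_nearbyRow_pair_le hTL0 hpair hj hm.1 h2m hAm hmemP hmemM
  have hinner_sum : |∑ m ∈ Finset.Icc (1 : ℤ) M₂, (f m + f (-m))| ≤
      R₁ * (A / (2 * π ^ 2 * j) + 200 * ℓ / (π * (T * Real.log T + j))) := by
    have hK0 : 0 ≤ A / (2 * π ^ 2 * j) + 200 * ℓ / (π * (T * Real.log T + j)) := by positivity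
    calc |∑ m ∈ Finset.Icc (1 : ℤ) M₂, (f m + f (-m))|
        ≤ ∑ m ∈ Finset.Icc (1 : ℤ) M₂, |f m + f (-m)| := Finset.abs_sum_le_sum_abs _ _
      _ ≤ ∑ m ∈ Finset.Icc (1 : ℤ) M₂, (A / (2 * π ^ 2 * j) + 200 * ℓ / (π * (T * Real.log T + j))) :=
          Finset.sum_le_sum hinner
      _ = (M₂ : ℝ) * (A / (2 * π ^ 2 * j) + 200 * ℓ / (π * (T * Real.log T + j))) := by
          rw [Finset.sum_const, nsmul_eq_mul, Int.card_Icc]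
          congr 1
          rw [show (M₂ + 1 - 1 : ℤ).toNat = M₂ by omega]
      _ ≤ R₁ * (A / (2 * π ^ 2 * j) + 200 * ℓ / (π * (T * Real.log T + j))) := by
          have : (M₂ : ℝ) ≤ R₁ := by linarith
          exact mul_le_mul_of_nonneg_right this hK0
  -- Step 5: the outer (annulus) terms
  have hMj : (M : ℝ) ≤ j / 2 := by
    have hM' : (M : ℝ) ≤ R₁ + 1 := by rw [hM]; exact (Nat.ceil_lt_add_one hR₁0).le
    linarith
  have hbound_out : ∀ m : ℤ, (M₂ : ℤ) < m → m ≤ M →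
      |f m| ≤ Cξ * (4 * logPlus j) / R₂ ∧ |f (-m)| ≤ Cξ * (4 * logPlus j) / R₂ := by
    intro m hm1 hm2
    have hmR₂ : R₂ ≤ (m : ℝ) := by
      have : (M₂ : ℝ) + 1 ≤ m := by exact_mod_cast hm1
      linarith
    have hm0 : (0 : ℝ) < m := hR₂0.trans_le hmR₂
    have hmj : (m : ℝ) ≤ j / 2 := by
      have : (m : ℝ) ≤ M := by exact_mod_cast hm2
      linarith
    have habs : |(m : ℝ)| = m := abs_of_pos hm0
    have habs' : |((-m : ℤ) : ℝ)| = m := by push_cast; rw [abs_neg, habs]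
    constructor
    · exact abs_nearbyRow_far_le hTL0 hCξ (hrow T hTL0) hj hR₂0 (by rw [habs]; exact hmR₂)
        (by rw [habs]; exact hmj)
    · exact abs_nearbyRow_far_le hTL0 hCξ (hrow T hTL0) hj hR₂0 (by rw [habs']; exact hmR₂)
        (by rw [habs']; exact hmj)
  -- at most one nonzero f m and one nonzero f (−m) on Ioc M₂ M
  have hthin_gen : ∀ (σ : ℤ → ℤ), (∀ n, |((σ n : ℤ) : ℝ)| = |(n : ℝ)|) →
      ∀ m ∈ (Finset.Ioc (M₂ : ℤ) M).filter (fun m ↦ |f (σ m)| ≠ 0),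
      ∀ m' ∈ (Finset.Ioc (M₂ : ℤ) M).filter (fun m ↦ |f (σ m)| ≠ 0), m = m' := by
    intro σ hσ m hm m' hm'
    rw [Finset.mem_filter, Finset.mem_Ioc] at hm hm'
    have nb : ∀ n : ℤ, |f (σ n)| ≠ 0 → |(n : ℝ)| < R₃ := fun n hn ↦ by
      rw [← hσ n]
      refine hnear_rad (σ n) ?_
      by_contra hmem
      exact hn (by rw [show f (σ n) = 0 from nearbyRow_eq_zero hmem, abs_zero])
    have h1 := nb m hm.2
    have h2 := nb m' hm'.2
    have e1 : (M₂ : ℝ) + 1 ≤ m := by exact_mod_cast hm.1.1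
    have e2 : (M₂ : ℝ) + 1 ≤ m' := by exact_mod_cast hm'.1.1
    rw [abs_of_pos (by linarith)] at h1
    rw [abs_of_pos (by linarith)] at h2
    exact nearby_int_eq_of_mem_thin_annulus hthin (by linarith) h1 (by linarith) h2
  have hB0 : 0 ≤ Cξ * (4 * logPlus j) / R₂ := by
    have := logPlus_nonneg (j : ℝ); positivity
  have hP : ∑ m ∈ Finset.Ioc (M₂ : ℤ) M, |f m| ≤ Cξ * (4 * logPlus j) / R₂ :=
    nearbyRow_sum_abs_le_of_filter_subsingleton hB0
      (fun m hm ↦ (hbound_out m (Finset.mem_Ioc.1 hm).1 (Finset.mem_Ioc.1 hm).2).1)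
      (hthin_gen id fun n ↦ rfl)
  have hM' : ∑ m ∈ Finset.Ioc (M₂ : ℤ) M, |f (-m)| ≤ Cξ * (4 * logPlus j) / R₂ :=
    nearbyRow_sum_abs_le_of_filter_subsingleton (g := fun m ↦ f (-m)) hB0
      (fun m hm ↦ (hbound_out m (Finset.mem_Ioc.1 hm).1 (Finset.mem_Ioc.1 hm).2).2)
      (hthin_gen Neg.neg fun n ↦ by push_cast; exact abs_neg _)
  have houter_sum : |∑ m ∈ Finset.Ioc (M₂ : ℤ) M, (f m + f (-m))| ≤
      2 * (Cξ * (4 * logPlus j) / R₂) := by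
    calc |∑ m ∈ Finset.Ioc (M₂ : ℤ) M, (f m + f (-m))|
        ≤ ∑ m ∈ Finset.Ioc (M₂ : ℤ) M, |f m + f (-m)| := Finset.abs_sum_le_sum_abs _ _
      _ ≤ ∑ m ∈ Finset.Ioc (M₂ : ℤ) M, (|f m| + |f (-m)|) :=
          Finset.sum_le_sum fun m _ ↦ abs_add_le _ _
      _ = ∑ m ∈ Finset.Ioc (M₂ : ℤ) M, |f m| + ∑ m ∈ Finset.Ioc (M₂ : ℤ) M, |f (-m)| :=
          Finset.sum_add_distrib
      _ ≤ _ := by linarith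
  -- Step 6: conversion of the three pieces to `C T^{-1/5} log₊ j`
  have hlog2 : Real.log 2 ≤ logPlus (j : ℝ) := log_two_le_logPlus _
  have hLj : 0 < logPlus (j : ℝ) := logPlus_pos _
  set τ : ℝ := T ^ (-(1 / 5 : ℝ)) with hτ
  have hτ0 : 0 < τ := Real.rpow_pos_of_pos hT0 _
  obtain ⟨ha, hb'⟩ := nearby_radius_ratio_le (R₁ := R₁) hT1 hlogT hj hjT hR₁0 hR₁le'
  have hc' : 1 / R₂ ≤ 6 / 5 * τ :=
    nearby_inv_inner_radius_le (N := N) hT0 hNT hR₂0 hbR₂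
  -- assemble
  have hpieces : |∑ m ∈ Finset.Icc (1 : ℤ) M₂, (f m + f (-m)) +
      ∑ m ∈ Finset.Ioc (M₂ : ℤ) M, (f m + f (-m))| ≤
      R₁ * (A / (2 * π ^ 2 * j) + 200 * ℓ / (π * (T * Real.log T + j))) +
        2 * (Cξ * (4 * logPlus j) / R₂) :=
    (abs_add_le _ _).trans (add_le_add hinner_sum houter_sum)
  refine hpieces.trans ?_
  have hA' : R₁ * (A / (2 * π ^ 2 * j)) ≤ A * τ * logPlus j := by
    have e : R₁ * (A / (2 * π ^ 2 * j)) = A / (2 * π ^ 2) * (R₁ / j) := by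
      field_simp
    rw [e]
    calc A / (2 * π ^ 2) * (R₁ / j) ≤ A / (2 * π ^ 2) * (16 / 5 * τ) :=
          mul_le_mul_of_nonneg_left ha (by positivity)
      _ = A * τ * (8 / (5 * π ^ 2)) := by field_simp; ring
      _ ≤ A * τ * Real.log 2 :=
          mul_le_mul_of_nonneg_left nearbyRow_numeric_one (by positivity)
      _ ≤ A * τ * logPlus j := mul_le_mul_of_nonneg_left hlog2 (by positivity)
  have hB' : R₁ * (200 * ℓ / (π * (T * Real.log T + j))) ≤ 214 * CL * τ * logPlus j := by
    have e : R₁ * (200 * ℓ / (π * (T * Real.log T + j))) =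
        200 / π * ℓ * (R₁ / (T * Real.log T + j)) := by
      field_simp
    rw [e]
    have h1 : 640 / π ≤ (214 : ℝ) := nearbyRow_numeric_two
    calc 200 / π * ℓ * (R₁ / (T * Real.log T + j))
        ≤ 200 / π * (CL * logPlus j) * (16 / 5 * τ) := by
          gcongr
      _ = (640 / π) * (CL * τ * logPlus j) := by ring
      _ ≤ 214 * (CL * τ * logPlus j) := mul_le_mul_of_nonneg_right h1 (by positivity)
      _ = 214 * CL * τ * logPlus j := by ring
  have hC' : 2 * (Cξ * (4 * logPlus j) / R₂) ≤ 10 * Cξ * τ * logPlus j := by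
    have e : 2 * (Cξ * (4 * logPlus j) / R₂) = 8 * Cξ * logPlus j * (1 / R₂) := by
      ring
    rw [e]
    calc 8 * Cξ * logPlus j * (1 / R₂) ≤ 8 * Cξ * logPlus j * (6 / 5 * τ) :=
          mul_le_mul_of_nonneg_left hc' (by positivity)
      _ = (48 / 5) * (Cξ * τ * logPlus j) := by ring
      _ ≤ 10 * (Cξ * τ * logPlus j) := mul_le_mul_of_nonneg_right (by norm_num) (by positivity)
      _ = 10 * Cξ * τ * logPlus j := by ring
  calc R₁ * (A / (2 * π ^ 2 * j) + 200 * ℓ / (π * (T * Real.log T + j))) + 2 * (Cξ * (4 * logPlus j) / R₂)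
      = R₁ * (A / (2 * π ^ 2 * j)) + R₁ * (200 * ℓ / (π * (T * Real.log T + j))) +
          2 * (Cξ * (4 * logPlus j) / R₂) := by ring
    _ ≤ A * τ * logPlus j + 214 * CL * τ * logPlus j + 10 * Cξ * τ * logPlus j := by
        linarith
    _ = (A + 214 * CL + 10 * Cξ) * T ^ (-(1 / 5 : ℝ)) * logPlus j := by rw [hτ]; ring

/-! ### §7 The weighted row sums: `Σ_j ψ_T(j) log₊(ξ_j) |S_j(T)| = o(T log³ T)` -/

/-- Small rows (`j² < T`): `|S_j(T)| ≤ K · T^{1/5} · log T` for `T ≥ 4` (the crude count: at most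
`≍ T^{1/5}` nearby indices, each term `≲ log T`). [cite: RodgersTaoFMP2020, §7 p. 44 (proof of Lemma 19)] -/
theorem exists_abs_tsum_nearbyRow_le_of_sq_lt :
    ∃ K : ℝ, 0 < K ∧ ∀ T : ℝ, 4 ≤ T → ∀ j : ℤ, (j : ℝ) ^ 2 < T →
      |∑' k : ℤ, (nearbyPairs T).indicator
        (fun p : ℤ × ℤ ↦ truncWeight T p.2 / (classicalLocationZ p.1 - classicalLocationZ p.2)) (j, k)| ≤
      K * T ^ (1 / 5 : ℝ) * Real.log T := by
  obtain ⟨C, hC, hcrude⟩ := exists_tsum_abs_nearbyRow_le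
  refine ⟨30 * C, by positivity, fun T hT j hjT ↦ ?_⟩
  have hT0 : 0 < T := by linarith
  have hT1 : 1 ≤ T := by linarith
  have hlogT : 1 ≤ Real.log T := by
    rw [← Real.log_exp 1]
    refine Real.log_le_log (Real.exp_pos 1) ?_
    have := Real.exp_one_lt_d9; linarith
  have hTL0 : 0 < T * Real.log T := by positivity
  obtain ⟨hs, hle⟩ := hcrude T hTL0 j
  -- |j| < √T ≤ T
  have hjabs : |(j : ℝ)| < Real.sqrt T := by
    rw [← Real.sqrt_sq_eq_abs]
    exact Real.sqrt_lt_sqrt (sq_nonneg _) hjT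
  have hsq1 : 1 ≤ Real.sqrt T := by
    rw [show (1 : ℝ) = Real.sqrt 1 by simp]; exact Real.sqrt_le_sqrt (by linarith)
  have hsqT : Real.sqrt T ≤ T := by
    have h := Real.mul_self_sqrt hT0.le
    calc Real.sqrt T = Real.sqrt T * 1 := (mul_one _).symm
      _ ≤ Real.sqrt T * Real.sqrt T :=
          mul_le_mul_of_nonneg_left hsq1 (Real.sqrt_nonneg _)
      _ = T := h
  have hj' : |(j : ℝ)| ≤ T := by linarith
  have hTT : 2 * T ≤ T ^ 2 := by
    rw [sq]; exact mul_le_mul_of_nonneg_right (by linarith) hT0.le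
  -- the radius
  set R₁ : ℝ := (2 * (T ^ 2 + 2 * |(j : ℝ)|)) ^ (1 / 10 : ℝ) + 2 with hR₁
  have hT5 : 1 ≤ T ^ (1 / 5 : ℝ) := Real.one_le_rpow hT1 (by norm_num)
  have hT5T : T ^ (1 / 5 : ℝ) ≤ T := by
    have := Real.rpow_le_rpow_of_exponent_le hT1 (show (1 / 5 : ℝ) ≤ 1 by norm_num)
    rwa [Real.rpow_one] at this
  have hrad : (2 * (T ^ 2 + 2 * |(j : ℝ)|)) ^ (1 / 10 : ℝ) ≤ 6 / 5 * T ^ (1 / 5 : ℝ) := by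
    have h1 : 2 * (T ^ 2 + 2 * |(j : ℝ)|) ≤ 4 * T ^ 2 := by linarith
    calc (2 * (T ^ 2 + 2 * |(j : ℝ)|)) ^ (1 / 10 : ℝ) ≤ (4 * T ^ 2) ^ (1 / 10 : ℝ) :=
          Real.rpow_le_rpow (by positivity) h1 (by norm_num)
      _ = 4 ^ (1 / 10 : ℝ) * (T ^ 2) ^ (1 / 10 : ℝ) := Real.mul_rpow (by norm_num) (by positivity)
      _ = 4 ^ (1 / 10 : ℝ) * T ^ (1 / 5 : ℝ) := by
          rw [← Real.rpow_natCast T 2, ← Real.rpow_mul hT0.le]; norm_num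
      _ ≤ 6 / 5 * T ^ (1 / 5 : ℝ) := mul_le_mul_of_nonneg_right nearby_four_rpow_tenth_le (by positivity)
  have hR₁0 : 0 ≤ R₁ := by positivity
  have hceil : (⌈R₁⌉ : ℝ) ≤ R₁ + 1 := (Int.ceil_lt_add_one R₁).le
  have hcount : (2 * (⌈R₁⌉ : ℝ) + 1) ≤ 10 * T ^ (1 / 5 : ℝ) := by
    have : R₁ ≤ 6 / 5 * T ^ (1 / 5 : ℝ) + 2 := by rw [hR₁]; linarith
    linarith
  have hlogarg : logPlus (2 * |(j : ℝ)| + R₁) ≤ 3 * Real.log T := by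
    rw [logPlus_eq, abs_of_nonneg (by positivity)]
    have h1 : 2 + (2 * |(j : ℝ)| + R₁) ≤ 8 * T := by
      have : R₁ ≤ 6 / 5 * T + 2 := by rw [hR₁]; linarith
      linarith
    have hlog8 : Real.log 8 ≤ 2 * Real.log T := by
      rw [show (8 : ℝ) = 2 ^ 3 by norm_num, Real.log_pow]
      have : Real.log 2 ≤ Real.log T / 2 := by
        have h4 : Real.log 4 ≤ Real.log T := Real.log_le_log (by norm_num) hT
        rw [show (4 : ℝ) = 2 ^ 2 by norm_num, Real.log_pow] at h4
        push_cast at h4; linarith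
      push_cast; linarith
    calc Real.log (2 + (2 * |(j : ℝ)| + R₁)) ≤ Real.log (8 * T) :=
          Real.log_le_log (by positivity) h1
      _ = Real.log 8 + Real.log T := Real.log_mul (by norm_num) hT0.ne'
      _ ≤ 3 * Real.log T := by linarith
  have hnorm : ‖∑' k : ℤ, (nearbyPairs T).indicator
        (fun p : ℤ × ℤ ↦ truncWeight T p.2 / (classicalLocationZ p.1 - classicalLocationZ p.2)) (j, k)‖
      ≤ ∑' k : ℤ, ‖(nearbyPairs T).indicator
        (fun p : ℤ × ℤ ↦ truncWeight T p.2 / (classicalLocationZ p.1 - classicalLocationZ p.2)) (j, k)‖ :=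
    norm_tsum_le_tsum_norm (by simpa only [Real.norm_eq_abs] using hs)
  simp only [Real.norm_eq_abs] at hnorm
  calc |∑' k : ℤ, (nearbyPairs T).indicator
        (fun p : ℤ × ℤ ↦ truncWeight T p.2 / (classicalLocationZ p.1 - classicalLocationZ p.2)) (j, k)|
      ≤ ∑' k : ℤ, |(nearbyPairs T).indicator
        (fun p : ℤ × ℤ ↦ truncWeight T p.2 / (classicalLocationZ p.1 - classicalLocationZ p.2)) (j, k)| :=
        hnorm
    _ ≤ C * (2 * ⌈R₁⌉ + 1) * logPlus (2 * |(j : ℝ)| + R₁) := hle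
    _ ≤ C * (10 * T ^ (1 / 5 : ℝ)) * (3 * Real.log T) :=
        mul_le_mul (mul_le_mul_of_nonneg_left hcount hC.le) hlogarg (logPlus_nonneg _)
          (by positivity)
    _ = 30 * C * T ^ (1 / 5 : ℝ) * Real.log T := by ring

/-- Large rows (`T ≤ j²`, `j ≠ 0`, both signs): `|S_j(T)| ≤ C T^{−1/5} log₊ j` (from the positive
case by the row symmetry `S_{−j} = −S_j`). [cite: RodgersTaoFMP2020, §7 p. 44 (proof of Lemma 19, (xikjd))] -/
theorem exists_abs_tsum_nearbyRow_le_of_le_sq :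
    ∃ C T₀ : ℝ, 0 < C ∧ 16 ≤ T₀ ∧ ∀ T : ℝ, T₀ ≤ T → ∀ j : ℤ, j ≠ 0 → T ≤ (j : ℝ) ^ 2 →
      |∑' k : ℤ, (nearbyPairs T).indicator
        (fun p : ℤ × ℤ ↦ truncWeight T p.2 / (classicalLocationZ p.1 - classicalLocationZ p.2)) (j, k)| ≤
      C * T ^ (-(1 / 5 : ℝ)) * logPlus j := by
  obtain ⟨C, T₀, hC, hT₀, h⟩ := exists_abs_tsum_nearbyRow_le
  refine ⟨C, T₀, hC, hT₀, fun T hT j hj hjT ↦ ?_⟩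
  rcases lt_or_gt_of_ne hj with hneg | hpos
  · have hj' : 0 < -j := by omega
    have hjT' : T ≤ ((-j : ℤ) : ℝ) ^ 2 := by push_cast; rwa [neg_sq]
    have := h T hT (-j) hj' hjT'
    have e := tsum_nearbyRow_neg T (-j)
    rw [neg_neg] at e
    rw [e, abs_neg]
    push_cast at this
    rwa [logPlus_neg] at this
  · exact h T hT j hpos hjT

/-- **The `t`-free core of Lemma 19, summed form** (v4 display (souse), FMP p. 44:
«`Σ_j ψ_T(j)|x_j − ξ_j| |Σ_{k : j∼_T k} ψ_T(k)/(ξ_j − ξ_k)| = o(T log³ T)`», here with the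
location-law size `log₊ ξ_j` in place of `|x_j − ξ_j|`): for every `ε > 0` there is `T₁` such that
for all `T ≥ T₁`, `Σ_{j ∈ ℤ} ψ_T(j) log₊(ξ_j) |S_j(T)| ≤ ε · T log³ T` (with summability), where
`S_j(T) = Σ_k 1[(j,k) nearby pair] ψ_T(k)/(ξ_j − ξ_k)`. RH-free, `t`-free: a statement about
`ψ_T`, `ξ_j` and `∼_T` only. [cite: RodgersTaoFMP2020, §7 p. 44 (proof of Lemma 19, display (souse) of arXiv v4)] -/
theorem nearbyRow_weighted_tsum_le :
    ∀ ε : ℝ, 0 < ε → ∃ T₁ : ℝ, 16 ≤ T₁ ∧ ∀ T : ℝ, T₁ ≤ T →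
      Summable (fun j : ℤ ↦ truncWeight T j * logPlus (classicalLocationZ j) *
        |∑' k : ℤ, (nearbyPairs T).indicator
          (fun p : ℤ × ℤ ↦ truncWeight T p.2 / (classicalLocationZ p.1 - classicalLocationZ p.2)) (j, k)|) ∧
      ∑' j : ℤ, truncWeight T j * logPlus (classicalLocationZ j) *
        |∑' k : ℤ, (nearbyPairs T).indicator
          (fun p : ℤ × ℤ ↦ truncWeight T p.2 / (classicalLocationZ p.1 - classicalLocationZ p.2)) (j, k)|
        ≤ ε * (T * Real.log T ^ 3) := by
  intro ε hε
  obtain ⟨K₁, hK₁, hsmall⟩ := exists_abs_tsum_nearbyRow_le_of_sq_lt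
  obtain ⟨K₂, T₀, hK₂, hT₀, hlarge⟩ := exists_abs_tsum_nearbyRow_le_of_le_sq
  obtain ⟨CL, hCL1, hlogξ⟩ := exists_logPlus_classicalLocationZ_le
  have hCL0 : 0 < CL := by linarith
  -- the constant in front of T^{-1/5} · T log³ T
  set K : ℝ := 90 * K₁ * CL + 40 * K₂ * CL with hK
  have hK0 : 0 < K := by positivity
  refine ⟨max T₀ ((K / ε) ^ 5), le_trans hT₀ (le_max_left _ _), fun T hT ↦ ?_⟩
  have hTT₀ : T₀ ≤ T := le_trans (le_max_left _ _) hT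
  have hTK : (K / ε) ^ 5 ≤ T := le_trans (le_max_right _ _) hT
  have hT16 : 16 ≤ T := le_trans hT₀ hTT₀
  have hT0 : 0 < T := by linarith
  have hT1 : 1 ≤ T := by linarith
  have hT3 : 3 ≤ T := by linarith
  obtain ⟨-, hlogT, hTL1⟩ := truncWeight_log_two_add_mul_log_le hT3
  have hTL0 : 0 < T * Real.log T := by linarith
  -- τ = T^{-1/5} ≤ ε / K
  set τ : ℝ := T ^ (-(1 / 5 : ℝ)) with hτ
  have hτ0 : 0 < τ := Real.rpow_pos_of_pos hT0 _
  have hτε : K * τ ≤ ε := by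
    have hKε : 0 < K / ε := by positivity
    have h1 : K / ε ≤ T ^ (1 / 5 : ℝ) := by
      calc K / ε = ((K / ε) ^ 5) ^ (1 / 5 : ℝ) := by
            rw [← Real.rpow_natCast (K / ε) 5, ← Real.rpow_mul hKε.le]; norm_num
        _ ≤ T ^ (1 / 5 : ℝ) := Real.rpow_le_rpow (by positivity) hTK (by norm_num)
    have h2 : τ ≤ ε / K := by
      rw [hτ, Real.rpow_neg hT0.le]
      calc (T ^ (1 / 5 : ℝ))⁻¹ ≤ (K / ε)⁻¹ := inv_anti₀ hKε h1
        _ = ε / K := by rw [inv_div]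
    have := mul_le_mul_of_nonneg_left h2 hK0.le
    rwa [mul_div_cancel₀ _ hK0.ne'] at this
  -- notation for the rows
  set S : ℤ → ℝ := fun j ↦ ∑' k : ℤ, (nearbyPairs T).indicator
    (fun p : ℤ × ℤ ↦ truncWeight T p.2 / (classicalLocationZ p.1 - classicalLocationZ p.2)) (j, k)
    with hS
  set g : ℤ → ℝ := fun j ↦ truncWeight T j * logPlus (classicalLocationZ j) * |S j| with hg
  -- the two majorants
  set B₁ : ℝ := CL * Real.log T * (K₁ * T ^ (1 / 5 : ℝ) * Real.log T) with hB₁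
  set b₁ : ℤ → ℝ := fun j ↦ if (j : ℝ) ^ 2 < T then B₁ else 0 with hb₁
  set b₂ : ℤ → ℝ := fun j ↦ CL * K₂ * τ * (truncWeight T j * logPlus j ^ 2) with hb₂
  have hB₁0 : 0 ≤ B₁ := by positivity
  have hg0 : ∀ j, 0 ≤ g j := fun j ↦ by
    simp only [hg]
    exact mul_nonneg (mul_nonneg (truncWeight_pos hTL0 j).le (logPlus_nonneg _)) (abs_nonneg _)
  have hS0 : S 0 = 0 := by
    simp only [hS]
    have : ∀ k : ℤ, (nearbyPairs T).indicator
        (fun p : ℤ × ℤ ↦ truncWeight T p.2 / (classicalLocationZ p.1 - classicalLocationZ p.2)) (0, k) = 0 :=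
      fun k ↦ nearbyRow_eq_zero (fun h ↦ ((mem_nearbyPairs (p := ((0 : ℤ), k))).1 h).1 rfl)
    simp only [this, tsum_zero]
  -- pointwise: g ≤ b₁ + b₂
  have hsqrtT : Real.sqrt T ≤ T / 2 := by
    rw [Real.sqrt_le_left (by linarith)]; nlinarith
  have hpt : ∀ j : ℤ, g j ≤ b₁ j + b₂ j := by
    intro j
    have hb₂0 : 0 ≤ b₂ j := by
      simp only [hb₂]
      exact mul_nonneg (by positivity) (mul_nonneg (truncWeight_pos hTL0 j).le (sq_nonneg _))
    by_cases hjT : (j : ℝ) ^ 2 < T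
    · -- small row
      have hψ1 : truncWeight T j ≤ 1 := truncWeight_le_one hTL0 j
      have hjabs : |(j : ℝ)| < Real.sqrt T := by
        rw [← Real.sqrt_sq_eq_abs]; exact Real.sqrt_lt_sqrt (sq_nonneg _) hjT
      have hlogj : logPlus (j : ℝ) ≤ Real.log T := by
        rw [logPlus_eq]
        refine (Real.log_le_log (by positivity) (by linarith : 2 + |(j : ℝ)| ≤ T))
      have hξ : logPlus (classicalLocationZ j) ≤ CL * Real.log T :=
        (hlogξ j).trans (mul_le_mul_of_nonneg_left hlogj hCL0.le)
      have hSj : |S j| ≤ K₁ * T ^ (1 / 5 : ℝ) * Real.log T := hsmall T (by linarith) j hjT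
      have : g j ≤ B₁ := by
        simp only [hg, hB₁]
        calc truncWeight T j * logPlus (classicalLocationZ j) * |S j|
            ≤ 1 * (CL * Real.log T) * (K₁ * T ^ (1 / 5 : ℝ) * Real.log T) :=
              mul_le_mul (mul_le_mul hψ1 hξ (logPlus_nonneg _) zero_le_one) hSj (abs_nonneg _)
                (by positivity)
          _ = _ := by ring
      simp only [hb₁, if_pos hjT]
      linarith
    · -- large row (or j = 0, impossible here since 0 < T)
      rw [not_lt] at hjT
      have hj : j ≠ 0 := by
        rintro rfl; simp at hjT; linarith
      have hSj : |S j| ≤ K₂ * τ * logPlus j := hlarge T hTT₀ j hj hjT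
      have : g j ≤ b₂ j := by
        simp only [hg, hb₂]
        have hψ0 : 0 ≤ truncWeight T j := (truncWeight_pos hTL0 j).le
        have hL0 : 0 ≤ logPlus (j : ℝ) := logPlus_nonneg _
        calc truncWeight T j * logPlus (classicalLocationZ j) * |S j|
            ≤ truncWeight T j * (CL * logPlus j) * (K₂ * τ * logPlus j) :=
              mul_le_mul (mul_le_mul_of_nonneg_left (hlogξ j) hψ0) hSj (abs_nonneg _)
                (mul_nonneg hψ0 (by positivity))
          _ = CL * K₂ * τ * (truncWeight T j * logPlus j ^ 2) := by ring
      have h0 : b₁ j = 0 := by simp only [hb₁, if_neg (not_lt.2 hjT)]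
      linarith
  -- summability and sums of the majorants
  obtain ⟨hsA, hA⟩ := tsum_truncWeight_mul_logPlus_sq_le hT3
  have hsb₂ : Summable b₂ := hsA.mul_left _
  have htb₂ : ∑' j, b₂ j ≤ CL * K₂ * τ * (40 * (T * Real.log T ^ 3)) := by
    rw [hb₂, tsum_mul_left]
    exact mul_le_mul_of_nonneg_left hA (by positivity)
  set I : Finset ℤ := Finset.Icc (-⌊Real.sqrt T⌋) ⌊Real.sqrt T⌋ with hI
  have hsupp₁ : ∀ j ∉ I, b₁ j = 0 := by
    intro j hj
    simp only [hb₁]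
    rw [if_neg]
    intro hjT
    apply hj
    have hjabs : |(j : ℝ)| < Real.sqrt T := by
      rw [← Real.sqrt_sq_eq_abs]; exact Real.sqrt_lt_sqrt (sq_nonneg _) hjT
    rw [hI, Finset.mem_Icc]
    have h1 := (abs_lt.1 hjabs)
    constructor
    · have : -⌊Real.sqrt T⌋ ≤ j := by
        rw [neg_le, Int.le_floor]; push_cast; linarith
      exact this
    · rw [Int.le_floor]; linarith
  have hsb₁ : Summable b₁ := summable_of_ne_finset_zero hsupp₁
  have hsq0 : 0 ≤ Real.sqrt T := Real.sqrt_nonneg T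
  have hfloor0 : 0 ≤ ⌊Real.sqrt T⌋ := Int.floor_nonneg.2 hsq0
  have htb₁ : ∑' j, b₁ j ≤ (2 * Real.sqrt T + 1) * B₁ := by
    rw [tsum_eq_sum hsupp₁]
    have hcard : (I.card : ℝ) ≤ 2 * Real.sqrt T + 1 := by
      obtain ⟨n, hn⟩ := Int.eq_ofNat_of_zero_le hfloor0
      rw [hI, Int.card_Icc, hn]
      have : ((n : ℤ) + 1 - -(n : ℤ)).toNat = 2 * n + 1 := by omega
      rw [this]; push_cast
      have : (n : ℝ) ≤ Real.sqrt T := by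
        have := Int.floor_le (Real.sqrt T); rw [hn] at this; exact_mod_cast this
      linarith
    calc ∑ j ∈ I, b₁ j ≤ ∑ j ∈ I, B₁ := Finset.sum_le_sum fun j _ ↦ by
            simp only [hb₁]; split_ifs <;> linarith
      _ = (I.card : ℝ) * B₁ := by rw [Finset.sum_const, nsmul_eq_mul]
      _ ≤ (2 * Real.sqrt T + 1) * B₁ := mul_le_mul_of_nonneg_right hcard hB₁0
  have hmaj : Summable (fun j ↦ b₁ j + b₂ j) := hsb₁.add hsb₂
  have hsg : Summable g := Summable.of_nonneg_of_le hg0 hpt hmaj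
  refine ⟨hsg, ?_⟩
  have htot : ∑' j, g j ≤ (2 * Real.sqrt T + 1) * B₁ + CL * K₂ * τ * (40 * (T * Real.log T ^ 3)) := by
    calc ∑' j, g j ≤ ∑' j, (b₁ j + b₂ j) := hsg.tsum_le_tsum hpt hmaj
      _ = ∑' j, b₁ j + ∑' j, b₂ j := hsb₁.tsum_add hsb₂
      _ ≤ _ := add_le_add htb₁ htb₂
  refine htot.trans ?_
  -- (2√T + 1) B₁ ≤ 3 √T · CL K₁ T^{1/5} log² T ≤ 90 K₁ CL τ T log³ T, and the τ-bound
  have hsq1 : 1 ≤ Real.sqrt T := by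
    rw [show (1 : ℝ) = Real.sqrt 1 by simp]; exact Real.sqrt_le_sqrt (by linarith)
  have hpow : Real.sqrt T * T ^ (1 / 5 : ℝ) ≤ T * τ := by
    rw [Real.sqrt_eq_rpow, ← Real.rpow_add hT0, hτ,
      show T * T ^ (-(1 / 5 : ℝ)) = T ^ (1 : ℝ) * T ^ (-(1 / 5 : ℝ)) by rw [Real.rpow_one],
      ← Real.rpow_add hT0]
    norm_num
    exact Real.rpow_le_rpow_of_exponent_le hT1 (by norm_num)
  have h1 : (2 * Real.sqrt T + 1) * B₁ ≤ 90 * K₁ * CL * τ * (T * Real.log T ^ 3) := by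
    have e : (2 * Real.sqrt T + 1) * B₁ =
        (2 * Real.sqrt T + 1) * T ^ (1 / 5 : ℝ) * (CL * K₁ * Real.log T ^ 2) := by
      rw [hB₁]; ring
    rw [e]
    have h3 : (2 * Real.sqrt T + 1) * T ^ (1 / 5 : ℝ) ≤ 3 * (T * τ) := by
      have : (2 * Real.sqrt T + 1) ≤ 3 * Real.sqrt T := by linarith
      calc (2 * Real.sqrt T + 1) * T ^ (1 / 5 : ℝ) ≤ 3 * Real.sqrt T * T ^ (1 / 5 : ℝ) :=
            mul_le_mul_of_nonneg_right this (by positivity)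
        _ = 3 * (Real.sqrt T * T ^ (1 / 5 : ℝ)) := by ring
        _ ≤ 3 * (T * τ) := by linarith
    have h4 : CL * K₁ * Real.log T ^ 2 ≤ CL * K₁ * Real.log T ^ 3 := by
      have : Real.log T ^ 2 ≤ Real.log T ^ 3 := by
        rw [show Real.log T ^ 3 = Real.log T ^ 2 * Real.log T by ring]
        exact le_mul_of_one_le_right (sq_nonneg _) hlogT
      exact mul_le_mul_of_nonneg_left this (by positivity)
    calc (2 * Real.sqrt T + 1) * T ^ (1 / 5 : ℝ) * (CL * K₁ * Real.log T ^ 2)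
        ≤ 3 * (T * τ) * (CL * K₁ * Real.log T ^ 3) :=
          mul_le_mul h3 h4 (by positivity) (by positivity)
      _ = 3 * K₁ * CL * τ * (T * Real.log T ^ 3) := by ring
      _ ≤ 90 * K₁ * CL * τ * (T * Real.log T ^ 3) := by
          have : 0 ≤ K₁ * CL * τ * (T * Real.log T ^ 3) := by positivity
          nlinarith
  have h2 : CL * K₂ * τ * (40 * (T * Real.log T ^ 3)) = 40 * K₂ * CL * τ * (T * Real.log T ^ 3) := by
    ring
  have hTL3 : 0 ≤ T * Real.log T ^ 3 := by positivity
  calc (2 * Real.sqrt T + 1) * B₁ + CL * K₂ * τ * (40 * (T * Real.log T ^ 3))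
      ≤ 90 * K₁ * CL * τ * (T * Real.log T ^ 3) + 40 * K₂ * CL * τ * (T * Real.log T ^ 3) := by
        rw [h2]; linarith
    _ = (K * τ) * (T * Real.log T ^ 3) := by rw [hK]; ring
    _ ≤ ε * (T * Real.log T ^ 3) := mul_le_mul_of_nonneg_right hτε hTL3

end Literature.NumberTheory.LFunctions

end
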